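import Literature.NumberTheory.DiophantineGeometry.TateAlgorithmPerfectField
import Literature.NumberTheory.DiophantineGeometry.MinimalModelUniquenessProofs
import HarnessLib

/-!
# Tate's algorithm is well defined: discharge of `WeierstrassCurve.kodairaSymbol_smul`

Trunk `DiophValNum` (companion proof file of
`Literature.NumberTheory.DiophantineGeometry.TateAlgorithm`; theorems only).

The named fact `WeierstrassCurve.kodairaSymbol_smul` of `TateAlgorithm` says: over a discrete
valuation ring `R` with *perfect* residue field `k` and fraction field `K`, the Kodaira symbol
`W.kodairaSymbol R` computed by the literal implementation of Tate's algorithm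
(`WeierstrassCurve.kodairaSymbolOfMinimal`, Silverman ATAEC IV.9.4, run on Mathlib's chosen
integral minimal model) is an invariant of the `K`-isomorphism class of an elliptic `W`, i.e.
independent of the model, of the minimal model chosen by `WeierstrassCurve.minimal`, and of all
normalising translations chosen by `Exists.choose` inside the algorithm. This file proves it
(`WeierstrassCurve.kodairaSymbol_smul_holds`).

The heart is `WeierstrassCurve.kodairaSymbolOfMinimal_smul`: for **any** Weierstrass equation `W`
over `R` (no minimality, no `Δ ≠ 0`) and any change of variables `D` over `R` (`u ∈ Rˣ`),
`kodairaSymbolOfMinimal (D • W) = kodairaSymbolOfMinimal W`. The two chosen minimal models of `W`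
and `C • W` are `K`-isomorphic minimal equations of an elliptic curve, hence differ by such a `D`
(Silverman AEC VII.1.3(b), `WeierstrassCurve.exists_variableChange_integralModel_eq`).

## Proof architecture (coupling two runs of the algorithm)

We run the algorithm on `W` and on `W' = D • W` simultaneously and show that at every step the
two current models `Wₖ`, `Wₖ'` are related by a change of variables `Dₖ` over `R` lying in the
subgroup for which the next test is invariant. Writing `Dₖ = (u; 0, 0, 0) · (1; r, s, t)`
(`smul_eq_rescale_smul`), rescalings are harmless (`dvd_rescale_*`, `*_rescale`), and for `u = 1`:

* **rigidity** — if both `Wₖ` and `(1; r, s, t) • Wₖ` are normalised as the algorithm guarantees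
  (by `Exists.choose_spec`), then `r, s, t` are divisible by the appropriate powers of `π`:
  step 2 (`π ∣ r, t`: uniqueness of the singular point of the reduction, via the identity
  `x³ = 2F − yF_y − xF_x`, `dvd_r_t_of_step2`), step 6 (`π ∣ r, s`, `π² ∣ t`,
  `dvd_r_s_t_of_step6`), the `Iₙ*` rounds (`π^{m+2} ∣ r, t` resp. `π^{m+3} ∣ t`, `π ∣ s`:
  uniqueness of the double root and induction on the level, `dvd_r_s_t_of_step7`, `…step7b`),
  step 8 (`π² ∣ r`: uniqueness of the triple root, `dvd_r_s_t_of_step8`), step 9 (`π³ ∣ t`,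
  `dvd_r_s_t_of_step9`);
* **invariance of the tests** under such changes: `b₂ ↦ b₂ + 12r`, `π² ∣ a₆`, `π³ ∣ b₈`,
  `π³ ∣ b₆` (using `π² ∣ b₄` from `4b₈ = b₂b₆ − b₄²`), `π⁴ ∣ a₄`, `π⁶ ∣ a₆`
  (`section DivisibilityTests`); the step-6 cubic and the quadratics of steps 7–9 are
  *translated* (`P(T) ↦ P(T + c)`, `distinctRootCount_cubicStep6_smul`,
  `distinctRootCount_quadratic₁_smul`, `distinctRootCount_quadratic₂_smul`) and, under
  rescalings, twisted coefficientwise by powers of `ū` so that their discriminants change by unit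
  factors (`…_rescale`); the number of distinct roots in `k̄` is unchanged
  (`distinctRootCount_C_mul_comp` and the characteristic-free root-count criteria of
  `TateAlgorithmRootCount` / `TateAlgorithmPerfectRoots`);
* **existence of the normalising translations** at every stage actually reached, over a perfect
  residue field of *any* characteristic (so that no junk branch of `normalizeStep2/6/8/9`,
  `istarIndex`, `istarIndexAux` is taken): these are the theorems of
  `Literature.NumberTheory.DiophantineGeometry.TateAlgorithmTranslationsProofs`
  (`exists_variableChange_step2_of_perfectField`, `…_step6/7/8/9_of_perfectField`,
  `…_istarA/B_of_perfectField`), consumed here in divisibility form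
  (`exists_variableChange_step6/7/8/9_of_dvd`, `exists_normalize_istarA/B`);
* the `Iₙ*` sub-procedure is handled by a coupled induction on the fuel
  (`istarIndexAux_smul_eq`, `istarIndex_smul_eq`), carrying `π ∥ a₂` along.

## References

* J. H. Silverman, *Advanced Topics in the Arithmetic of Elliptic Curves*, GTM 151, Springer
  1994, IV.9, Tate's algorithm 9.4: Steps 1–11 (PDF pp. 344–346), in particular Step 2 ("make a
  change of variables to move the singular point to `(0,0)`"), Step 6 (the factorisations
  `Y² + a₁Y − a₂ ≡ (Y − α)²`, `Y² + a₃,₁Y − a₆,₂ ≡ (Y − β)²` and `y' = y + αx + βπ`), Step 7 and its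
  subprocedure ("translate `x` so that the double root of `P(T)` is `T = 0`. Then `π² ∤ a₂` …"),
  Steps 8–10; proofs of Steps 7 and 11 (PDF pp. 351–355); the standing hypothesis that residue
  fields are perfect (PDF p. 272).
* J. Tate, *Algorithm for determining the type of a singular fiber in an elliptic pencil*, in
  Modular Functions of One Variable IV, LNM 476, Springer 1975, 33–52, §§7–8.
* J. H. Silverman, *The Arithmetic of Elliptic Curves*, 2nd ed., GTM 106, 2009, Prop. VII.1.3(b)
  (PDF p. 165).
-/

open Polynomial IsLocalRing

namespace Literature.NumberTheory.DiophantineGeometry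

namespace TateAlgorithm

/-! ### Distinct-root counts under affine substitutions -/

section RootCount

variable {R : Type*} [CommRing R] [IsDomain R] [IsDiscreteValuationRing R]

/-- The number of distinct roots in `k̄` is invariant under `P ↦ c · P(a T + b)` for `a, c ≠ 0`
(the roots correspond under the affine bijection `x ↦ a x + b` of `k̄`). This is the invariance of
the tests of steps 6–8 of Tate's algorithm under admissible changes of the normalised model
(Silverman ATAEC IV.9.4; module docstring of `TateAlgorithm`, "Dependence on choices"). [folklore] -/
theorem distinctRootCount_C_mul_comp {a c : ResidueField R} (ha : a ≠ 0) (hc : c ≠ 0)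
    (b : ResidueField R) (P : (ResidueField R)[X]) :
    distinctRootCount (C c * P.comp (C a * X + C b)) = distinctRootCount P := by
  classical
  unfold distinctRootCount
  set L := AlgebraicClosure (ResidueField R)
  have ha' : IsUnit (algebraMap (ResidueField R) L a) :=
    (IsUnit.mk0 a ha).map (algebraMap (ResidueField R) L)
  have key := (P.map (algebraMap (ResidueField R) L)).map_roots_comp_C_mul_X_add_C
    (algebraMap (ResidueField R) L a) (algebraMap (ResidueField R) L b) ha'
  rw [aroots_C_mul _ hc, aroots_def, Polynomial.map_comp]
  simp only [Polynomial.map_add, Polynomial.map_mul, map_C, map_X]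
  conv_rhs => rw [aroots_def, ← key]
  rw [Multiset.toFinset_map, Finset.card_image_of_injective]
  intro x y hxy
  simpa [ha'.ne_zero] using hxy

/-- Special case: translation `T ↦ T + b`. [folklore] -/
theorem distinctRootCount_comp_X_add_C (b : ResidueField R) (P : (ResidueField R)[X]) :
    distinctRootCount (P.comp (X + C b)) = distinctRootCount P := by
  have h := distinctRootCount_C_mul_comp (one_ne_zero) (one_ne_zero) b P
  rwa [C_1, one_mul, one_mul] at h

end RootCount

/-! ### Rescalings `(u; 0, 0, 0)` -/

section Rescale

variable {R : Type*} [CommRing R]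

/-- Coefficients of a rescaled equation: `aᵢ ↦ u⁻ⁱ aᵢ`. [folklore] -/
theorem rescale_a₁ (u : Rˣ) (W : WeierstrassCurve R) :
    ((⟨u, 0, 0, 0⟩ : WeierstrassCurve.VariableChange R) • W).a₁ = ↑u⁻¹ * W.a₁ := by
  rw [WeierstrassCurve.variableChange_a₁]; ring

/-- Coefficients of a rescaled equation: `aᵢ ↦ u⁻ⁱ aᵢ`. [folklore] -/
theorem rescale_a₂ (u : Rˣ) (W : WeierstrassCurve R) :
    ((⟨u, 0, 0, 0⟩ : WeierstrassCurve.VariableChange R) • W).a₂ = ↑u⁻¹ ^ 2 * W.a₂ := by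
  rw [WeierstrassCurve.variableChange_a₂]; ring

/-- Coefficients of a rescaled equation: `aᵢ ↦ u⁻ⁱ aᵢ`. [folklore] -/
theorem rescale_a₃ (u : Rˣ) (W : WeierstrassCurve R) :
    ((⟨u, 0, 0, 0⟩ : WeierstrassCurve.VariableChange R) • W).a₃ = ↑u⁻¹ ^ 3 * W.a₃ := by
  rw [WeierstrassCurve.variableChange_a₃]; ring

/-- Coefficients of a rescaled equation: `aᵢ ↦ u⁻ⁱ aᵢ`. [folklore] -/
theorem rescale_a₄ (u : Rˣ) (W : WeierstrassCurve R) :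
    ((⟨u, 0, 0, 0⟩ : WeierstrassCurve.VariableChange R) • W).a₄ = ↑u⁻¹ ^ 4 * W.a₄ := by
  rw [WeierstrassCurve.variableChange_a₄]; ring

/-- Coefficients of a rescaled equation: `aᵢ ↦ u⁻ⁱ aᵢ`. [folklore] -/
theorem rescale_a₆ (u : Rˣ) (W : WeierstrassCurve R) :
    ((⟨u, 0, 0, 0⟩ : WeierstrassCurve.VariableChange R) • W).a₆ = ↑u⁻¹ ^ 6 * W.a₆ := by
  rw [WeierstrassCurve.variableChange_a₆]; ring

/-- Invariants of a rescaled equation: `bᵢ ↦ u⁻ⁱ bᵢ`. [folklore] -/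
theorem rescale_b₂ (u : Rˣ) (W : WeierstrassCurve R) :
    ((⟨u, 0, 0, 0⟩ : WeierstrassCurve.VariableChange R) • W).b₂ = ↑u⁻¹ ^ 2 * W.b₂ := by
  rw [WeierstrassCurve.variableChange_b₂]; ring

/-- Invariants of a rescaled equation: `bᵢ ↦ u⁻ⁱ bᵢ`. [folklore] -/
theorem rescale_b₆ (u : Rˣ) (W : WeierstrassCurve R) :
    ((⟨u, 0, 0, 0⟩ : WeierstrassCurve.VariableChange R) • W).b₆ = ↑u⁻¹ ^ 6 * W.b₆ := by
  rw [WeierstrassCurve.variableChange_b₆]; ring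

/-- Invariants of a rescaled equation: `bᵢ ↦ u⁻ⁱ bᵢ`. [folklore] -/
theorem rescale_b₈ (u : Rˣ) (W : WeierstrassCurve R) :
    ((⟨u, 0, 0, 0⟩ : WeierstrassCurve.VariableChange R) • W).b₈ = ↑u⁻¹ ^ 8 * W.b₈ := by
  rw [WeierstrassCurve.variableChange_b₈]; ring

/-- Divisibility is insensitive to a unit power factor. [folklore] -/
theorem dvd_units_inv_pow_mul_iff (u : Rˣ) (n : ℕ) (d x : R) : d ∣ ↑u⁻¹ ^ n * x ↔ d ∣ x :=
  ((Units.isUnit u⁻¹).pow n).dvd_mul_left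

/-- Every change of variables is a `u = 1` change followed by a rescaling:
`(u; r, s, t) = (u; 0, 0, 0) * (1; r, s, t)`. [folklore] -/
theorem VariableChange.eq_rescale_mul_of_u (D : WeierstrassCurve.VariableChange R) :
    D = ⟨D.u, 0, 0, 0⟩ * ⟨1, D.r, D.s, D.t⟩ := by
  rw [WeierstrassCurve.VariableChange.mul_def]
  ext <;> simp

end Rescale

/-! ### Rigidity of the normalised models (changes with `u = 1`) -/

section Rigidity

variable {R : Type*} [CommRing R] [IsDomain R] [IsDiscreteValuationRing R]

/-- **Step 2 rigidity** (uniqueness of the singular point of the reduction): if `W` and `D • W`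
(`u = 1`) both have `π ∣ a₃, a₄, a₆`, i.e. `(0, 0)` is a singular point of both reductions, then
`π ∣ r` and `π ∣ t` — the reduction of `D` fixes `(0, 0)`. The proof is the polynomial identity
`x³ = 2 F − y F_y − x F_x` for the singular point `(x, y) = (r̄, t̄)` of `ȳ² + ā₁ x̄ȳ = x̄³ + ā₂ x̄²`.
Silverman ATAEC IV.9.4, Step 2 ("change coordinates so that the singular point is `(0,0)`").
[cite: SilvermanATAEC1994, IV.9.4 Step 2] -/
theorem dvd_r_t_of_step2 {W : WeierstrassCurve R} {D : WeierstrassCurve.VariableChange R}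
    (hu : D.u = 1) (h3 : uniformizer R ∣ W.a₃) (h4 : uniformizer R ∣ W.a₄)
    (h6 : uniformizer R ∣ W.a₆) (h3' : uniformizer R ∣ (D • W).a₃)
    (h4' : uniformizer R ∣ (D • W).a₄) (h6' : uniformizer R ∣ (D • W).a₆) :
    uniformizer R ∣ D.r ∧ uniformizer R ∣ D.t := by
  have hϖ : Irreducible (uniformizer R) := irreducible_uniformizer
  have z3 := residue_eq_zero_of_dvd hϖ h3
  have z4 := residue_eq_zero_of_dvd hϖ h4
  have z6 := residue_eq_zero_of_dvd hϖ h6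
  have e3 := residue_eq_zero_of_dvd hϖ h3'
  have e4 := residue_eq_zero_of_dvd hϖ h4'
  have e6 := residue_eq_zero_of_dvd hϖ h6'
  rw [smul_a₃_of_u_eq_one hu] at e3
  rw [smul_a₄_of_u_eq_one hu] at e4
  rw [smul_a₆_of_u_eq_one hu] at e6
  simp only [map_add, map_sub, map_mul, map_pow, map_ofNat, z3, z4, z6] at e3 e4 e6
  set x := residue R D.r
  set y := residue R D.t
  set σ := residue R D.s
  set A₁ := residue R W.a₁
  set A₂ := residue R W.a₂
  have hx3 : x ^ 3 = 0 := by linear_combination -2 * e6 - y * e3 + x * e4 + x * σ * e3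
  have hx : x = 0 := pow_eq_zero_iff three_ne_zero |>.mp hx3
  have hy2 : y ^ 2 = 0 := by
    rw [hx] at e6
    linear_combination -e6
  have hy : y = 0 := pow_eq_zero_iff two_ne_zero |>.mp hy2
  exact ⟨(dvd_iff_residue_eq_zero hϖ _).mpr hx, (dvd_iff_residue_eq_zero hϖ _).mpr hy⟩

/-- **Step 6 rigidity**: if `W` and `D • W` (`u = 1`) are both step-6 normalised
(`π ∣ a₁, a₂`, `π² ∣ a₃, a₄`, `π³ ∣ a₆`) then `π ∣ r`, `π ∣ s`, `π² ∣ t`; the only freedom left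
is `x ↦ x + r` with `π ∣ r`, which translates the step-6 cubic. Silverman ATAEC IV.9.4, Step 6
(module docstring of `TateAlgorithm`, "Dependence on choices"). [cite: SilvermanATAEC1994, IV.9.4 Step 6] -/
theorem dvd_r_s_t_of_step6 {W : WeierstrassCurve R} {D : WeierstrassCurve.VariableChange R}
    (hu : D.u = 1) (h1 : uniformizer R ∣ W.a₁) (h2 : uniformizer R ∣ W.a₂)
    (h3 : uniformizer R ^ 2 ∣ W.a₃) (h4 : uniformizer R ^ 2 ∣ W.a₄)
    (h6 : uniformizer R ^ 3 ∣ W.a₆) (_h1' : uniformizer R ∣ (D • W).a₁)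
    (h2' : uniformizer R ∣ (D • W).a₂) (h3' : uniformizer R ^ 2 ∣ (D • W).a₃)
    (h4' : uniformizer R ^ 2 ∣ (D • W).a₄) (h6' : uniformizer R ^ 3 ∣ (D • W).a₆) :
    uniformizer R ∣ D.r ∧ uniformizer R ∣ D.s ∧ uniformizer R ^ 2 ∣ D.t := by
  have hϖ : Irreducible (uniformizer R) := irreducible_uniformizer
  set ϖ := uniformizer R with hϖdef
  have hϖ2 : ϖ ∣ ϖ ^ 2 := dvd_pow_self ϖ two_ne_zero
  have hϖ3 : ϖ ∣ ϖ ^ 3 := dvd_pow_self ϖ three_ne_zero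
  obtain ⟨hr, ht⟩ := dvd_r_t_of_step2 hu (hϖ2.trans h3) (hϖ2.trans h4) (hϖ3.trans h6)
    (hϖ2.trans h3') (hϖ2.trans h4') (hϖ3.trans h6')
  -- `s`
  have z1 := residue_eq_zero_of_dvd hϖ h1
  have z2 := residue_eq_zero_of_dvd hϖ h2
  have zr := residue_eq_zero_of_dvd hϖ hr
  have e2 := residue_eq_zero_of_dvd hϖ h2'
  rw [smul_a₂_of_u_eq_one hu] at e2
  simp only [map_add, map_sub, map_mul, map_pow, map_ofNat, z1, z2, zr] at e2
  have hs2 : residue R D.s ^ 2 = 0 := by linear_combination -e2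
  have hs : ϖ ∣ D.s :=
    (dvd_iff_residue_eq_zero hϖ _).mpr (pow_eq_zero_iff two_ne_zero |>.mp hs2)
  refine ⟨hr, hs, ?_⟩
  -- `t`
  obtain ⟨α, hα⟩ := h1
  obtain ⟨β, hβ⟩ := h2
  obtain ⟨γ, hγ⟩ := h3
  obtain ⟨δ, hδ⟩ := h4
  obtain ⟨ε, hε⟩ := h6
  obtain ⟨ρ, hρ⟩ := hr
  obtain ⟨σ, hσ⟩ := hs
  obtain ⟨τ, hτ⟩ := ht
  have key : ϖ ^ 3 ∣ ϖ ^ 2 * τ ^ 2 := by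
    have e : ϖ ^ 2 * τ ^ 2 = ϖ ^ 3 * (ε + ρ * δ + ρ ^ 2 * β + ρ ^ 3 - τ * γ - ρ * τ * α) -
        (D • W).a₆ := by
      rw [smul_a₆_of_u_eq_one hu, hα, hβ, hγ, hδ, hε, hρ, hτ]; ring
    rw [e]
    exact dvd_sub (dvd_mul_right _ _) h6'
  rw [pow_succ, mul_dvd_mul_iff_left (pow_ne_zero 2 hϖ.ne_zero)] at key
  obtain ⟨τ', hτ'⟩ := hϖ.prime.dvd_of_dvd_pow key
  exact ⟨τ', by rw [hτ, hτ']; ring⟩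

/-- **Step 8 rigidity**: if `W` and `D • W` (`u = 1`) are both step-8 normalised
(`π ∣ a₁`, `π² ∣ a₂, a₃`, `π³ ∣ a₄`, `π⁴ ∣ a₆`) then `π² ∣ r`, `π ∣ s`, `π² ∣ t` (uniqueness of
the triple root of the step-6 cubic: `π⁴ ∣ r³`). Silverman ATAEC IV.9.4, Step 8.
[cite: SilvermanATAEC1994, IV.9.4 Step 8] -/
theorem dvd_r_s_t_of_step8 {W : WeierstrassCurve R} {D : WeierstrassCurve.VariableChange R}
    (hu : D.u = 1) (h1 : uniformizer R ∣ W.a₁) (h2 : uniformizer R ^ 2 ∣ W.a₂)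
    (h3 : uniformizer R ^ 2 ∣ W.a₃) (h4 : uniformizer R ^ 3 ∣ W.a₄)
    (h6 : uniformizer R ^ 4 ∣ W.a₆) (h1' : uniformizer R ∣ (D • W).a₁)
    (h2' : uniformizer R ^ 2 ∣ (D • W).a₂) (h3' : uniformizer R ^ 2 ∣ (D • W).a₃)
    (h4' : uniformizer R ^ 3 ∣ (D • W).a₄) (h6' : uniformizer R ^ 4 ∣ (D • W).a₆) :
    uniformizer R ^ 2 ∣ D.r ∧ uniformizer R ∣ D.s ∧ uniformizer R ^ 2 ∣ D.t := by
  have hϖ : Irreducible (uniformizer R) := irreducible_uniformizer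
  set ϖ := uniformizer R with hϖdef
  have d12 : ϖ ∣ ϖ ^ 2 := dvd_pow_self ϖ two_ne_zero
  have d23 : ϖ ^ 2 ∣ ϖ ^ 3 := pow_dvd_pow ϖ (by norm_num)
  have d34 : ϖ ^ 3 ∣ ϖ ^ 4 := pow_dvd_pow ϖ (by norm_num)
  obtain ⟨hr, hs, ht⟩ := dvd_r_s_t_of_step6 hu h1 (d12.trans h2) h3 (d23.trans h4)
    (d34.trans h6) h1' (d12.trans h2') h3' (d23.trans h4') (d34.trans h6')
  refine ⟨?_, hs, ht⟩
  obtain ⟨α, hα⟩ := h1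
  obtain ⟨β, hβ⟩ := h2
  obtain ⟨γ, hγ⟩ := h3
  obtain ⟨δ, hδ⟩ := h4
  obtain ⟨ε, hε⟩ := h6
  obtain ⟨ρ, hρ⟩ := hr
  obtain ⟨σ, hσ⟩ := hs
  obtain ⟨τ, hτ⟩ := ht
  have key : ϖ ^ 4 ∣ ϖ ^ 3 * ρ ^ 3 := by
    have e : ϖ ^ 3 * ρ ^ 3 = (D • W).a₆ - ϖ ^ 4 * (ε + ρ * δ + ρ ^ 2 * β - τ * γ - τ ^ 2
        - ρ * τ * α) := by
      rw [smul_a₆_of_u_eq_one hu, hα, hβ, hγ, hδ, hε, hρ, hτ]; ring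
    rw [e]
    exact dvd_sub h6' (dvd_mul_right _ _)
  rw [pow_succ ϖ 3, mul_dvd_mul_iff_left (pow_ne_zero 3 hϖ.ne_zero)] at key
  obtain ⟨ρ', hρ'⟩ := hϖ.prime.dvd_of_dvd_pow key
  exact ⟨ρ', by rw [hρ, hρ']; ring⟩

/-- **Step 9 rigidity**: if `W` and `D • W` (`u = 1`) are both step-9 normalised
(`π ∣ a₁`, `π² ∣ a₂`, `π³ ∣ a₃, a₄`, `π⁵ ∣ a₆`) then `π² ∣ r`, `π ∣ s`, `π³ ∣ t` (uniqueness of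
the double root of the step-8 quadratic: `π⁵ ∣ t²`). Silverman ATAEC IV.9.4, Step 9.
[cite: SilvermanATAEC1994, IV.9.4 Step 9] -/
theorem dvd_r_s_t_of_step9 {W : WeierstrassCurve R} {D : WeierstrassCurve.VariableChange R}
    (hu : D.u = 1) (h1 : uniformizer R ∣ W.a₁) (h2 : uniformizer R ^ 2 ∣ W.a₂)
    (h3 : uniformizer R ^ 3 ∣ W.a₃) (h4 : uniformizer R ^ 3 ∣ W.a₄)
    (h6 : uniformizer R ^ 5 ∣ W.a₆) (h1' : uniformizer R ∣ (D • W).a₁)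
    (h2' : uniformizer R ^ 2 ∣ (D • W).a₂) (h3' : uniformizer R ^ 3 ∣ (D • W).a₃)
    (h4' : uniformizer R ^ 3 ∣ (D • W).a₄) (h6' : uniformizer R ^ 5 ∣ (D • W).a₆) :
    uniformizer R ^ 2 ∣ D.r ∧ uniformizer R ∣ D.s ∧ uniformizer R ^ 3 ∣ D.t := by
  have hϖ : Irreducible (uniformizer R) := irreducible_uniformizer
  set ϖ := uniformizer R with hϖdef
  have d23 : ϖ ^ 2 ∣ ϖ ^ 3 := pow_dvd_pow ϖ (by norm_num)
  have d45 : ϖ ^ 4 ∣ ϖ ^ 5 := pow_dvd_pow ϖ (by norm_num)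
  obtain ⟨hr, hs, ht⟩ := dvd_r_s_t_of_step8 hu h1 h2 (d23.trans h3) h4 (d45.trans h6) h1' h2'
    (d23.trans h3') h4' (d45.trans h6')
  refine ⟨hr, hs, ?_⟩
  obtain ⟨α, hα⟩ := h1
  obtain ⟨β, hβ⟩ := h2
  obtain ⟨γ, hγ⟩ := h3
  obtain ⟨δ, hδ⟩ := h4
  obtain ⟨ε, hε⟩ := h6
  obtain ⟨ρ, hρ⟩ := hr
  obtain ⟨σ, hσ⟩ := hs
  obtain ⟨τ, hτ⟩ := ht
  have key : ϖ ^ 5 ∣ ϖ ^ 4 * τ ^ 2 := by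
    have e : ϖ ^ 4 * τ ^ 2 = ϖ ^ 5 * (ε + ρ * δ + ϖ * ρ ^ 2 * β + ϖ * ρ ^ 3 - τ * γ
        - ρ * τ * α) - (D • W).a₆ := by
      rw [smul_a₆_of_u_eq_one hu, hα, hβ, hγ, hδ, hε, hρ, hτ]; ring
    rw [e]
    exact dvd_sub (dvd_mul_right _ _) h6'
  rw [pow_succ ϖ 4, mul_dvd_mul_iff_left (pow_ne_zero 4 hϖ.ne_zero)] at key
  obtain ⟨τ', hτ'⟩ := hϖ.prime.dvd_of_dvd_pow key
  exact ⟨τ', by rw [hτ, hτ']; ring⟩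

end Rigidity
section Rigidity7

variable {R : Type*} [CommRing R] [IsDomain R] [IsDiscreteValuationRing R]

/-- **Step 7 rigidity** (the `Iₙ*` sub-procedure, start of round `m`): if `W` and `D • W`
(`u = 1`) both satisfy `π ∣ a₁, a₂`, `π^{m+2} ∣ a₃`, `π^{m+3} ∣ a₄`, `π^{2m+4} ∣ a₆`, and
`π² ∤ a₂ (W)`, then `π^{m+2} ∣ r`, `π ∣ s`, `π^{m+2} ∣ t`. For `m = 0` this is the uniqueness of
the double root `T = 0` of the step-6 cubic `T²(T + a₂,₁)`; the higher congruences follow by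
induction on the level from the `a₆`-transformation formula. Silverman ATAEC IV.9.4, Step 7.
[cite: SilvermanATAEC1994, IV.9.4 Step 7] -/
theorem dvd_r_s_t_of_step7 {W : WeierstrassCurve R} {D : WeierstrassCurve.VariableChange R}
    (hu : D.u = 1) {m : ℕ} (h1 : uniformizer R ∣ W.a₁) (h2 : uniformizer R ∣ W.a₂)
    (h2n : ¬ uniformizer R ^ 2 ∣ W.a₂) (h3 : uniformizer R ^ (m + 2) ∣ W.a₃)
    (h4 : uniformizer R ^ (m + 3) ∣ W.a₄) (h6 : uniformizer R ^ (2 * m + 4) ∣ W.a₆)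
    (h1' : uniformizer R ∣ (D • W).a₁) (h2' : uniformizer R ∣ (D • W).a₂)
    (h3' : uniformizer R ^ (m + 2) ∣ (D • W).a₃) (h4' : uniformizer R ^ (m + 3) ∣ (D • W).a₄)
    (h6' : uniformizer R ^ (2 * m + 4) ∣ (D • W).a₆) :
    uniformizer R ^ (m + 2) ∣ D.r ∧ uniformizer R ∣ D.s ∧ uniformizer R ^ (m + 2) ∣ D.t := by
  have hϖ : Irreducible (uniformizer R) := irreducible_uniformizer
  set ϖ := uniformizer R with hϖdef
  have hP := hϖ.prime
  -- step-6 rigidity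
  obtain ⟨hr, hs, ht⟩ := dvd_r_s_t_of_step6 hu h1 h2
    ((pow_dvd_pow ϖ (by omega : 2 ≤ m + 2)).trans h3)
    ((pow_dvd_pow ϖ (by omega : 2 ≤ m + 3)).trans h4)
    ((pow_dvd_pow ϖ (by omega : 3 ≤ 2 * m + 4)).trans h6) h1' h2'
    ((pow_dvd_pow ϖ (by omega : 2 ≤ m + 2)).trans h3')
    ((pow_dvd_pow ϖ (by omega : 2 ≤ m + 3)).trans h4')
    ((pow_dvd_pow ϖ (by omega : 3 ≤ 2 * m + 4)).trans h6')
  obtain ⟨α, hα⟩ := h1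
  obtain ⟨β, hβ⟩ := h2
  have hβn : ¬ ϖ ∣ β := fun h => h2n (by rw [hβ, pow_two]; exact mul_dvd_mul_left ϖ h)
  obtain ⟨σ, hσ⟩ := hs
  -- `π² ∣ r`: uniqueness of the double root
  have hr2 : ϖ ^ 2 ∣ D.r := by
    obtain ⟨ρ, hρ⟩ := hr
    obtain ⟨τ, hτ⟩ := ht
    obtain ⟨γ, hγ⟩ := (pow_dvd_pow ϖ (by omega : 2 ≤ m + 2)).trans h3
    obtain ⟨δ, hδ⟩ := (pow_dvd_pow ϖ (by omega : 3 ≤ m + 3)).trans h4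
    obtain ⟨ε, hε⟩ := (pow_dvd_pow ϖ (by omega : 4 ≤ 2 * m + 4)).trans h6
    have k4 : ϖ ∣ ρ * (2 * β + 3 * ρ) := by
      have e : ϖ ^ 2 * (ρ * (2 * β + 3 * ρ)) = (D • W).a₄ - ϖ ^ 3 * (δ - σ * γ - τ * α
          - ρ * σ * α - 2 * σ * τ) := by
        rw [smul_a₄_of_u_eq_one hu, hα, hβ, hγ, hδ, hρ, hσ, hτ]; ring
      have : ϖ ^ 3 ∣ ϖ ^ 2 * (ρ * (2 * β + 3 * ρ)) := by
        rw [e]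
        exact dvd_sub ((pow_dvd_pow ϖ (by omega : 3 ≤ m + 3)).trans h4') (dvd_mul_right _ _)
      rwa [pow_succ ϖ 2, mul_dvd_mul_iff_left (pow_ne_zero 2 hϖ.ne_zero)] at this
    have k6 : ϖ ∣ ρ ^ 2 * (β + ρ) := by
      have e : ϖ ^ 3 * (ρ ^ 2 * (β + ρ)) = (D • W).a₆ - ϖ ^ 4 * (ε + ρ * δ - τ * γ - τ ^ 2
          - ρ * τ * α) := by
        rw [smul_a₆_of_u_eq_one hu, hα, hβ, hγ, hδ, hε, hρ, hτ]; ring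
      have : ϖ ^ 4 ∣ ϖ ^ 3 * (ρ ^ 2 * (β + ρ)) := by
        rw [e]
        exact dvd_sub ((pow_dvd_pow ϖ (by omega : 4 ≤ 2 * m + 4)).trans h6')
          (dvd_mul_right _ _)
      rwa [pow_succ ϖ 3, mul_dvd_mul_iff_left (pow_ne_zero 3 hϖ.ne_zero)] at this
    have hρ1 : ϖ ∣ ρ := by
      have z4 := residue_eq_zero_of_dvd hϖ k4
      have z6 := residue_eq_zero_of_dvd hϖ k6
      simp only [map_add, map_mul, map_pow, map_ofNat] at z4 z6
      have hb : residue R β ≠ 0 := fun h => hβn ((dvd_iff_residue_eq_zero hϖ _).mpr h)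
      rw [dvd_iff_residue_eq_zero hϖ]
      by_contra hρ0
      have e4 : 2 * residue R β + 3 * residue R ρ = 0 := (mul_eq_zero.mp z4).resolve_left hρ0
      have e6 : residue R β + residue R ρ = 0 :=
        (mul_eq_zero.mp z6).resolve_left (pow_ne_zero 2 hρ0)
      exact hb (by linear_combination 3 * e6 - e4)
    obtain ⟨ρ', hρ'⟩ := hρ1
    exact ⟨ρ', by rw [hρ, hρ', pow_two]; ring⟩
  -- induction on the level
  have main : ∀ i, i ≤ m → ϖ ^ (i + 2) ∣ D.r ∧ ϖ ^ (i + 2) ∣ D.t := by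
    intro i
    induction i with
    | zero => exact fun _ => ⟨hr2, ht⟩
    | succ i ih =>
      intro hi
      obtain ⟨⟨ρ, hρ⟩, ⟨τ, hτ⟩⟩ := ih (by omega)
      obtain ⟨d, rfl⟩ : ∃ d, m = i + 1 + d := ⟨m - (i + 1), by omega⟩
      obtain ⟨γ, hγ⟩ := id h3
      obtain ⟨δ, hδ⟩ := id h4
      obtain ⟨ε, hε⟩ := id h6
      -- upgrade `t`
      have kt : ϖ ∣ τ := by
        have e : ϖ ^ (2 * i + 4) * τ ^ 2 = ϖ ^ (2 * i + 5) * (ϖ ^ (2 * d + 1) * ε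
            + ϖ ^ (d + 1) * ρ * δ + ρ ^ 2 * β + ϖ ^ (i + 1) * ρ ^ 3 - ϖ ^ d * τ * γ
            - ρ * τ * α) - (D • W).a₆ := by
          rw [smul_a₆_of_u_eq_one hu, hα, hβ, hγ, hδ, hε, hρ, hτ]; ring
        have : ϖ ^ (2 * i + 5) ∣ ϖ ^ (2 * i + 4) * τ ^ 2 := by
          rw [e]
          exact dvd_sub (dvd_mul_right _ _)
            ((pow_dvd_pow ϖ (by omega : 2 * i + 5 ≤ 2 * (i + 1 + d) + 4)).trans h6')
        rw [pow_succ ϖ (2 * i + 4), mul_dvd_mul_iff_left (pow_ne_zero _ hϖ.ne_zero)] at this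
        exact hP.dvd_of_dvd_pow this
      obtain ⟨τ₁, rfl⟩ := kt
      -- upgrade `r`
      have kr : ϖ ∣ ρ := by
        have e : ϖ ^ (2 * i + 5) * (ρ ^ 2 * β) = (D • W).a₆ - ϖ ^ (2 * i + 6) * (ϖ ^ (2 * d) * ε
            + ϖ ^ d * ρ * δ + ϖ ^ i * ρ ^ 3 - ϖ ^ d * τ₁ * γ - τ₁ ^ 2 - ρ * τ₁ * α) := by
          rw [smul_a₆_of_u_eq_one hu, hα, hβ, hγ, hδ, hε, hρ, hτ]; ring
        have : ϖ ^ (2 * i + 6) ∣ ϖ ^ (2 * i + 5) * (ρ ^ 2 * β) := by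
          rw [e]
          exact dvd_sub ((pow_dvd_pow ϖ (by omega : 2 * i + 6 ≤ 2 * (i + 1 + d) + 4)).trans h6')
            (dvd_mul_right _ _)
        rw [pow_succ ϖ (2 * i + 5), mul_dvd_mul_iff_left (pow_ne_zero _ hϖ.ne_zero)] at this
        exact hP.dvd_of_dvd_pow ((hP.dvd_or_dvd this).resolve_right hβn)
      obtain ⟨ρ₁, rfl⟩ := kr
      exact ⟨⟨ρ₁, by rw [hρ]; ring⟩, ⟨τ₁, by rw [hτ]; ring⟩⟩
  exact ⟨(main m le_rfl).1, ⟨σ, hσ⟩, (main m le_rfl).2⟩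

/-- **Step 7 rigidity, second half of round `m`**: if `W` and `D • W` (`u = 1`) both satisfy
`π ∣ a₁, a₂`, `π^{m+3} ∣ a₃, a₄`, `π^{2m+5} ∣ a₆`, and `π² ∤ a₂ (W)`, then `π^{m+2} ∣ r`,
`π ∣ s`, `π^{m+3} ∣ t`. Silverman ATAEC IV.9.4, Step 7. [cite: SilvermanATAEC1994, IV.9.4 Step 7] -/
theorem dvd_r_s_t_of_step7b {W : WeierstrassCurve R} {D : WeierstrassCurve.VariableChange R}
    (hu : D.u = 1) {m : ℕ} (h1 : uniformizer R ∣ W.a₁) (h2 : uniformizer R ∣ W.a₂)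
    (h2n : ¬ uniformizer R ^ 2 ∣ W.a₂) (h3 : uniformizer R ^ (m + 3) ∣ W.a₃)
    (h4 : uniformizer R ^ (m + 3) ∣ W.a₄) (h6 : uniformizer R ^ (2 * m + 5) ∣ W.a₆)
    (h1' : uniformizer R ∣ (D • W).a₁) (h2' : uniformizer R ∣ (D • W).a₂)
    (h3' : uniformizer R ^ (m + 3) ∣ (D • W).a₃) (h4' : uniformizer R ^ (m + 3) ∣ (D • W).a₄)
    (h6' : uniformizer R ^ (2 * m + 5) ∣ (D • W).a₆) :
    uniformizer R ^ (m + 2) ∣ D.r ∧ uniformizer R ∣ D.s ∧ uniformizer R ^ (m + 3) ∣ D.t := by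
  have hϖ : Irreducible (uniformizer R) := irreducible_uniformizer
  set ϖ := uniformizer R with hϖdef
  obtain ⟨hr, hs, ht⟩ := dvd_r_s_t_of_step7 hu h1 h2 h2n
    ((pow_dvd_pow ϖ (by omega : m + 2 ≤ m + 3)).trans h3) h4
    ((pow_dvd_pow ϖ (by omega : 2 * m + 4 ≤ 2 * m + 5)).trans h6) h1' h2'
    ((pow_dvd_pow ϖ (by omega : m + 2 ≤ m + 3)).trans h3') h4'
    ((pow_dvd_pow ϖ (by omega : 2 * m + 4 ≤ 2 * m + 5)).trans h6')
  refine ⟨hr, hs, ?_⟩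
  obtain ⟨α, hα⟩ := h1
  obtain ⟨β, hβ⟩ := h2
  obtain ⟨γ, hγ⟩ := h3
  obtain ⟨δ, hδ⟩ := h4
  obtain ⟨ε, hε⟩ := h6
  obtain ⟨ρ, hρ⟩ := hr
  obtain ⟨τ, hτ⟩ := ht
  have kt : ϖ ∣ τ := by
    have e : ϖ ^ (2 * m + 4) * τ ^ 2 = ϖ ^ (2 * m + 5) * (ε + ρ * δ + ρ ^ 2 * β
        + ϖ ^ (m + 1) * ρ ^ 3 - τ * γ - ρ * τ * α) - (D • W).a₆ := by
      rw [smul_a₆_of_u_eq_one hu, hα, hβ, hγ, hδ, hε, hρ, hτ]; ring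
    have : ϖ ^ (2 * m + 5) ∣ ϖ ^ (2 * m + 4) * τ ^ 2 := by
      rw [e]; exact dvd_sub (dvd_mul_right _ _) h6'
    rw [pow_succ ϖ (2 * m + 4), mul_dvd_mul_iff_left (pow_ne_zero _ hϖ.ne_zero)] at this
    exact hϖ.prime.dvd_of_dvd_pow this
  obtain ⟨τ₁, rfl⟩ := kt
  exact ⟨τ₁, by rw [hτ]; ring⟩

end Rigidity7

section DivisibilityTests

variable {R : Type*} [CommRing R] [IsDomain R] [IsDiscreteValuationRing R]

/-- Step 2 test under a `u = 1` change with `π ∣ r`: `b₂ ↦ b₂ + 12 r`. [folklore] -/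
theorem dvd_b₂_smul_iff {W : WeierstrassCurve R} {D : WeierstrassCurve.VariableChange R}
    (hu : D.u = 1) (hr : uniformizer R ∣ D.r) :
    uniformizer R ∣ (D • W).b₂ ↔ uniformizer R ∣ W.b₂ := by
  rw [WeierstrassCurve.variableChange_b₂, hu, inv_one, Units.val_one, one_pow, one_mul]
  exact dvd_add_left (dvd_mul_of_dvd_right hr 12)

/-- Step 3 test (`π² ∣ a₆`) under a `u = 1` change with `π ∣ r, t` between step-2 normalised
models. [folklore] -/
theorem sq_dvd_a₆_smul_iff {W : WeierstrassCurve R} {D : WeierstrassCurve.VariableChange R}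
    (hu : D.u = 1) (h3 : uniformizer R ∣ W.a₃) (h4 : uniformizer R ∣ W.a₄)
    (hr : uniformizer R ∣ D.r) (ht : uniformizer R ∣ D.t) :
    uniformizer R ^ 2 ∣ (D • W).a₆ ↔ uniformizer R ^ 2 ∣ W.a₆ := by
  set ϖ := uniformizer R
  obtain ⟨γ, hγ⟩ := h3
  obtain ⟨δ, hδ⟩ := h4
  obtain ⟨ρ, hρ⟩ := hr
  obtain ⟨τ, hτ⟩ := ht
  have e : (D • W).a₆ = W.a₆ + ϖ ^ 2 * (ρ * δ + ρ ^ 2 * W.a₂ + ϖ * ρ ^ 3 - τ * γ - τ ^ 2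
      - ρ * τ * W.a₁) := by
    rw [smul_a₆_of_u_eq_one hu, hγ, hδ, hρ, hτ]; ring
  rw [e]
  exact dvd_add_left (dvd_mul_right _ _)

/-- Step 4 test (`π³ ∣ b₈`) under a `u = 1` change with `π ∣ r` between step-2 normalised models
with `π² ∣ a₆`: `b₈ ↦ b₈ + 3 r b₆ + 3 r² b₄ + r³ b₂ + 3 r⁴` with `π² ∣ b₆`, `π ∣ b₄`. [folklore] -/
theorem cube_dvd_b₈_smul_iff {W : WeierstrassCurve R} {D : WeierstrassCurve.VariableChange R}
    (hu : D.u = 1) (h3 : uniformizer R ∣ W.a₃) (h4 : uniformizer R ∣ W.a₄)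
    (h6 : uniformizer R ^ 2 ∣ W.a₆) (hr : uniformizer R ∣ D.r) :
    uniformizer R ^ 3 ∣ (D • W).b₈ ↔ uniformizer R ^ 3 ∣ W.b₈ := by
  set ϖ := uniformizer R
  obtain ⟨γ, hγ⟩ := h3
  obtain ⟨δ, hδ⟩ := h4
  obtain ⟨ε, hε⟩ := h6
  obtain ⟨ρ, hρ⟩ := hr
  have e : (D • W).b₈ = W.b₈ + ϖ ^ 3 * (3 * ρ * (γ ^ 2 + 4 * ε)
      + 3 * ρ ^ 2 * (2 * δ + W.a₁ * γ) + ρ ^ 3 * W.b₂ + 3 * ϖ * ρ ^ 4) := by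
    rw [WeierstrassCurve.variableChange_b₈, hu, inv_one, Units.val_one, one_pow, one_mul,
      WeierstrassCurve.b₄, WeierstrassCurve.b₆, hγ, hδ, hε, hρ]; ring
  rw [e]
  exact dvd_add_left (dvd_mul_right _ _)

/-- On a step-2 normalised model with `π ∣ b₂`, `π² ∣ a₆`, `π³ ∣ b₈` one has `π² ∣ b₄`
(from `4 b₈ = b₂ b₆ − b₄²`). [folklore] -/
theorem sq_dvd_b₄_of_step5 {W : WeierstrassCurve R} (h3 : uniformizer R ∣ W.a₃)
    (h6 : uniformizer R ^ 2 ∣ W.a₆) (hb₂ : uniformizer R ∣ W.b₂)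
    (hb₈ : uniformizer R ^ 3 ∣ W.b₈) : uniformizer R ^ 2 ∣ W.b₄ := by
  have hϖ : Irreducible (uniformizer R) := irreducible_uniformizer
  set ϖ := uniformizer R
  have hb₆ : ϖ ^ 2 ∣ W.b₆ := by
    obtain ⟨γ, hγ⟩ := h3
    obtain ⟨ε, hε⟩ := h6
    exact ⟨γ ^ 2 + 4 * ε, by rw [WeierstrassCurve.b₆, hγ, hε]; ring⟩
  have h : ϖ ^ 3 ∣ W.b₄ ^ 2 := by
    have e : W.b₄ ^ 2 = W.b₂ * W.b₆ - 4 * W.b₈ := by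
      linear_combination W.b_relation
    rw [e]
    exact dvd_sub (by rw [pow_succ' ϖ 2]; exact mul_dvd_mul hb₂ hb₆)
      (dvd_mul_of_dvd_right hb₈ 4)
  exact pow_succ_dvd_of_pow_dvd_sq hϖ (k := 1) h

/-- Step 5 test (`π³ ∣ b₆`) under a `u = 1` change with `π ∣ r` between step-2 normalised models
with `π ∣ b₂`, `π² ∣ a₆`, `π³ ∣ b₈`: `b₆ ↦ b₆ + 2 r b₄ + r² b₂ + 4 r³` with `π² ∣ b₄`. [folklore] -/
theorem cube_dvd_b₆_smul_iff {W : WeierstrassCurve R} {D : WeierstrassCurve.VariableChange R}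
    (hu : D.u = 1) (h3 : uniformizer R ∣ W.a₃) (h6 : uniformizer R ^ 2 ∣ W.a₆)
    (hb₂ : uniformizer R ∣ W.b₂) (hb₈ : uniformizer R ^ 3 ∣ W.b₈) (hr : uniformizer R ∣ D.r) :
    uniformizer R ^ 3 ∣ (D • W).b₆ ↔ uniformizer R ^ 3 ∣ W.b₆ := by
  set ϖ := uniformizer R
  obtain ⟨B₄, hB₄⟩ := sq_dvd_b₄_of_step5 h3 h6 hb₂ hb₈
  obtain ⟨B₂, hB₂⟩ := hb₂
  obtain ⟨ρ, hρ⟩ := hr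
  have e : (D • W).b₆ = W.b₆ + ϖ ^ 3 * (2 * ρ * B₄ + ρ ^ 2 * B₂ + 4 * ρ ^ 3) := by
    rw [WeierstrassCurve.variableChange_b₆, hu, inv_one, Units.val_one, one_pow, one_mul, hB₄,
      hB₂, hρ]; ring
  rw [e]
  exact dvd_add_left (dvd_mul_right _ _)

/-- Step 9 test (`π⁴ ∣ a₄`) under a `u = 1` change with `π² ∣ r`, `π ∣ s`, `π³ ∣ t` between
step-9 normalised models. [folklore] -/
theorem pow_four_dvd_a₄_smul_iff {W : WeierstrassCurve R} {D : WeierstrassCurve.VariableChange R}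
    (hu : D.u = 1) (h1 : uniformizer R ∣ W.a₁) (h2 : uniformizer R ^ 2 ∣ W.a₂)
    (h3 : uniformizer R ^ 3 ∣ W.a₃) (hr : uniformizer R ^ 2 ∣ D.r) (hs : uniformizer R ∣ D.s)
    (ht : uniformizer R ^ 3 ∣ D.t) :
    uniformizer R ^ 4 ∣ (D • W).a₄ ↔ uniformizer R ^ 4 ∣ W.a₄ := by
  set ϖ := uniformizer R
  obtain ⟨α, hα⟩ := h1
  obtain ⟨β, hβ⟩ := h2
  obtain ⟨γ, hγ⟩ := h3
  obtain ⟨ρ, hρ⟩ := hr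
  obtain ⟨σ, hσ⟩ := hs
  obtain ⟨τ, hτ⟩ := ht
  have e : (D • W).a₄ = W.a₄ + ϖ ^ 4 * (-(σ * γ) + 2 * ρ * β - τ * α - ρ * σ * α + 3 * ρ ^ 2
      - 2 * σ * τ) := by
    rw [smul_a₄_of_u_eq_one hu, hα, hβ, hγ, hρ, hσ, hτ]; ring
  rw [e]
  exact dvd_add_left (dvd_mul_right _ _)

/-- Step 10 test (`π⁶ ∣ a₆`) under a `u = 1` change with `π² ∣ r`, `π ∣ s`, `π³ ∣ t` between
step-9 normalised models with `π⁴ ∣ a₄`. [folklore] -/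
theorem pow_six_dvd_a₆_smul_iff {W : WeierstrassCurve R} {D : WeierstrassCurve.VariableChange R}
    (hu : D.u = 1) (h1 : uniformizer R ∣ W.a₁) (h2 : uniformizer R ^ 2 ∣ W.a₂)
    (h3 : uniformizer R ^ 3 ∣ W.a₃) (h4 : uniformizer R ^ 4 ∣ W.a₄) (hr : uniformizer R ^ 2 ∣ D.r)
    (ht : uniformizer R ^ 3 ∣ D.t) :
    uniformizer R ^ 6 ∣ (D • W).a₆ ↔ uniformizer R ^ 6 ∣ W.a₆ := by
  set ϖ := uniformizer R
  obtain ⟨α, hα⟩ := h1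
  obtain ⟨β, hβ⟩ := h2
  obtain ⟨γ, hγ⟩ := h3
  obtain ⟨δ, hδ⟩ := h4
  obtain ⟨ρ, hρ⟩ := hr
  obtain ⟨τ, hτ⟩ := ht
  have e : (D • W).a₆ = W.a₆ + ϖ ^ 6 * (ρ * δ + ρ ^ 2 * β + ρ ^ 3 - τ * γ - τ ^ 2
      - ρ * τ * α) := by
    rw [smul_a₆_of_u_eq_one hu, hα, hβ, hγ, hδ, hρ, hτ]; ring
  rw [e]
  exact dvd_add_left (dvd_mul_right _ _)

end DivisibilityTests

section PolyTests

variable {R : Type*} [CommRing R] [IsDomain R] [IsDiscreteValuationRing R]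

/-- Translate of the quadratic `X² + a X − c`. [folklore] -/
theorem sq_add_sub_comp_X_add_C {k : Type*} [CommRing k] (a c θ : k) :
    (X ^ 2 + C a * X - C c : k[X]).comp (X + C θ) =
      X ^ 2 + C (a + 2 * θ) * X - C (c - a * θ - θ ^ 2) := by
  simp only [sub_comp, add_comp, mul_comp, pow_comp, X_comp, C_comp, map_add, map_sub, map_mul,
    map_pow, map_ofNat]
  ring

/-- Translate of the quadratic `a X² + b X + c`. [folklore] -/
theorem quadratic_comp_X_add_C {k : Type*} [CommRing k] (a b c ρ : k) :
    (C a * X ^ 2 + C b * X + C c : k[X]).comp (X + C ρ) =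
      C a * X ^ 2 + C (b + 2 * a * ρ) * X + C (c + b * ρ + a * ρ ^ 2) := by
  simp only [add_comp, mul_comp, pow_comp, X_comp, C_comp, map_add, map_mul, map_pow, map_ofNat]
  ring

/-- Characteristic-free: `X² + a X − c` has two distinct roots in `k̄` iff `a² + 4c ≠ 0`.
[folklore] -/
theorem distinctRootCount_sq_add_sub_eq_two_iff (a c : ResidueField R) :
    distinctRootCount (X ^ 2 + C a * X - C c) = 2 ↔ a ^ 2 + 4 * c ≠ 0 := by
  classical
  unfold distinctRootCount
  convert card_aroots_toFinset_sq_add_sub_eq_two_iff_ne_zero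
    (L := AlgebraicClosure (ResidueField R)) a c

/-- Characteristic-free: `a X² + b X + c` (`a ≠ 0`) has two distinct roots in `k̄` iff
`b² − 4ac ≠ 0`. [folklore] -/
theorem distinctRootCount_quadratic_eq_two_iff_ne_zero {a : ResidueField R} (ha : a ≠ 0)
    (b c : ResidueField R) :
    distinctRootCount (C a * X ^ 2 + C b * X + C c) = 2 ↔ b ^ 2 - 4 * a * c ≠ 0 := by
  classical
  unfold distinctRootCount
  convert card_aroots_toFinset_quadratic_eq_two_iff_ne_zero
    (L := AlgebraicClosure (ResidueField R)) ha b c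

/-! #### `u = 1` changes: the auxiliary polynomials are translated -/

/-- Step 6 cubic under an admissible `u = 1` change between step-6 normalised models
(`π ∣ r, s`, `π² ∣ t`): `P ↦ P(T + r̄/π)`, so the number of distinct roots is unchanged.
Silverman ATAEC IV.9.4, Step 6–7 ("Dependence on choices" in the module docstring of
`TateAlgorithm`). [cite: SilvermanATAEC1994, IV.9.4 Steps 6–7] -/
theorem distinctRootCount_cubicStep6_smul {W : WeierstrassCurve R}
    {D : WeierstrassCurve.VariableChange R} (hu : D.u = 1) (h1 : uniformizer R ∣ W.a₁)
    (h2 : uniformizer R ∣ W.a₂) (h3 : uniformizer R ^ 2 ∣ W.a₃) (h4 : uniformizer R ^ 2 ∣ W.a₄)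
    (h6 : uniformizer R ^ 3 ∣ W.a₆) (hr : uniformizer R ∣ D.r) (hs : uniformizer R ∣ D.s)
    (ht : uniformizer R ^ 2 ∣ D.t) :
    distinctRootCount (cubicStep6 (D • W)) = distinctRootCount (cubicStep6 W) := by
  have hϖ : Irreducible (uniformizer R) := irreducible_uniformizer
  have hres0 : residue R (uniformizer R) = 0 := residue_uniformizer_eq_zero hϖ
  set ϖ := uniformizer R with hϖdef
  obtain ⟨α, hα⟩ := h1
  obtain ⟨β, hβ⟩ := h2
  obtain ⟨γ, hγ⟩ := h3
  obtain ⟨δ, hδ⟩ := h4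
  obtain ⟨ε, hε⟩ := h6
  obtain ⟨ρ, hρ⟩ := hr
  obtain ⟨σ, hσ⟩ := hs
  obtain ⟨τ, hτ⟩ := ht
  have c2 : redCoeff (D • W).a₂ 1 = residue R β + 3 * residue R ρ := by
    have e : (D • W).a₂ = ϖ * (β + 3 * ρ - ϖ * (σ * α + σ ^ 2)) := by
      rw [smul_a₂_of_u_eq_one hu, hα, hβ, hρ, hσ]; ring
    rw [e, redCoeff_uniformizer_mul]
    simp only [map_add, map_sub, map_mul, map_pow, map_ofNat, hres0, zero_mul, sub_zero]
  have c4 : redCoeff (D • W).a₄ 2 =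
      residue R δ + 2 * residue R β * residue R ρ + 3 * residue R ρ ^ 2 := by
    have e : (D • W).a₄ = ϖ ^ 2 * (δ + 2 * β * ρ + 3 * ρ ^ 2
        - ϖ * (σ * γ + τ * α + ρ * σ * α + 2 * σ * τ)) := by
      rw [smul_a₄_of_u_eq_one hu, hα, hβ, hγ, hδ, hρ, hσ, hτ]; ring
    rw [e, redCoeff_uniformizer_pow_mul]
    simp only [map_add, map_sub, map_mul, map_pow, map_ofNat, hres0, zero_mul, sub_zero]
  have c6 : redCoeff (D • W).a₆ 3 = residue R ε + residue R δ * residue R ρ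
      + residue R β * residue R ρ ^ 2 + residue R ρ ^ 3 := by
    have e : (D • W).a₆ = ϖ ^ 3 * (ε + δ * ρ + β * ρ ^ 2 + ρ ^ 3
        - ϖ * (τ * γ + τ ^ 2 + ρ * τ * α)) := by
      rw [smul_a₆_of_u_eq_one hu, hα, hβ, hγ, hδ, hε, hρ, hτ]; ring
    rw [e, redCoeff_uniformizer_pow_mul]
    simp only [map_add, map_sub, map_mul, map_pow, hres0, zero_mul, sub_zero]
  have w2 : redCoeff W.a₂ 1 = residue R β := by rw [hβ, redCoeff_uniformizer_mul]
  have w4 : redCoeff W.a₄ 2 = residue R δ := by rw [hδ, redCoeff_uniformizer_pow_mul]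
  have w6 : redCoeff W.a₆ 3 = residue R ε := by rw [hε, redCoeff_uniformizer_pow_mul]
  have key : cubicStep6 (D • W) = (cubicStep6 W).comp (X + C (residue R ρ)) := by
    rw [cubicStep6, cubicStep6, c2, c4, c6, w2, w4, w6, cubic_comp_X_add_C]
  rw [key, distinctRootCount_comp_X_add_C]

/-- Step 7, first quadratic of round `m` (`Y² + a₃,ₘ₊₂ Y − a₆,₂ₘ₊₄`; for `m = 0` this is also
the step-8 quadratic) under an admissible `u = 1` change (`π^{m+2} ∣ r, t`, `π ∣ s`) between
round-`m` normalised models: `Q ↦ Q(Y + t̄/π^{m+2})`, so the number of distinct roots is unchanged.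
Silverman ATAEC IV.9.4, Step 7. [cite: SilvermanATAEC1994, IV.9.4 Step 7] -/
theorem distinctRootCount_quadratic₁_smul {W : WeierstrassCurve R}
    {D : WeierstrassCurve.VariableChange R} (hu : D.u = 1) {m : ℕ} (h1 : uniformizer R ∣ W.a₁)
    (h2 : uniformizer R ∣ W.a₂) (h3 : uniformizer R ^ (m + 2) ∣ W.a₃)
    (h4 : uniformizer R ^ (m + 3) ∣ W.a₄) (h6 : uniformizer R ^ (2 * m + 4) ∣ W.a₆)
    (hr : uniformizer R ^ (m + 2) ∣ D.r) (hs : uniformizer R ∣ D.s)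
    (ht : uniformizer R ^ (m + 2) ∣ D.t) :
    distinctRootCount (X ^ 2 + C (redCoeff (D • W).a₃ (m + 2)) * X
        - C (redCoeff (D • W).a₆ (2 * m + 4))) =
      distinctRootCount (X ^ 2 + C (redCoeff W.a₃ (m + 2)) * X - C (redCoeff W.a₆ (2 * m + 4))) := by
  have hϖ : Irreducible (uniformizer R) := irreducible_uniformizer
  have hres0 : residue R (uniformizer R) = 0 := residue_uniformizer_eq_zero hϖ
  set ϖ := uniformizer R with hϖdef
  obtain ⟨α, hα⟩ := h1
  obtain ⟨β, hβ⟩ := h2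
  obtain ⟨γ, hγ⟩ := h3
  obtain ⟨δ, hδ⟩ := h4
  obtain ⟨ε, hε⟩ := h6
  obtain ⟨ρ, hρ⟩ := hr
  obtain ⟨σ, hσ⟩ := hs
  obtain ⟨τ, hτ⟩ := ht
  have c3 : redCoeff (D • W).a₃ (m + 2) = residue R γ + 2 * residue R τ := by
    have e : (D • W).a₃ = ϖ ^ (m + 2) * (γ + 2 * τ + ϖ * (ρ * α)) := by
      rw [smul_a₃_of_u_eq_one hu, hα, hγ, hρ, hτ]; ring
    rw [e, redCoeff_uniformizer_pow_mul]
    simp only [map_add, map_mul, map_ofNat, hres0, zero_mul, add_zero]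
  have c6 : redCoeff (D • W).a₆ (2 * m + 4) =
      residue R ε - residue R γ * residue R τ - residue R τ ^ 2 := by
    have e : (D • W).a₆ = ϖ ^ (2 * m + 4) * (ε - γ * τ - τ ^ 2
        + ϖ * (ρ * δ + ρ ^ 2 * β + ϖ ^ (m + 1) * ρ ^ 3 - ρ * τ * α)) := by
      rw [smul_a₆_of_u_eq_one hu, hα, hβ, hγ, hδ, hε, hρ, hτ]; ring
    rw [e, redCoeff_uniformizer_pow_mul]
    simp only [map_add, map_sub, map_mul, map_pow, hres0, zero_mul, add_zero]
  have w3 : redCoeff W.a₃ (m + 2) = residue R γ := by rw [hγ, redCoeff_uniformizer_pow_mul]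
  have w6 : redCoeff W.a₆ (2 * m + 4) = residue R ε := by rw [hε, redCoeff_uniformizer_pow_mul]
  rw [c3, c6, w3, w6, ← sq_add_sub_comp_X_add_C, distinctRootCount_comp_X_add_C]

/-- Step 7, second quadratic of round `m` (`a₂,₁ X² + a₄,ₘ₊₃ X + a₆,₂ₘ₊₅`) under an admissible
`u = 1` change (`π^{m+2} ∣ r`, `π ∣ s`, `π^{m+3} ∣ t`) between the corresponding normalised
models: `Q ↦ Q(X + r̄/π^{m+2})`, so the number of distinct roots is unchanged.
Silverman ATAEC IV.9.4, Step 7. [cite: SilvermanATAEC1994, IV.9.4 Step 7] -/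
theorem distinctRootCount_quadratic₂_smul {W : WeierstrassCurve R}
    {D : WeierstrassCurve.VariableChange R} (hu : D.u = 1) {m : ℕ} (h1 : uniformizer R ∣ W.a₁)
    (h2 : uniformizer R ∣ W.a₂) (h3 : uniformizer R ^ (m + 3) ∣ W.a₃)
    (h4 : uniformizer R ^ (m + 3) ∣ W.a₄) (h6 : uniformizer R ^ (2 * m + 5) ∣ W.a₆)
    (hr : uniformizer R ^ (m + 2) ∣ D.r) (hs : uniformizer R ∣ D.s)
    (ht : uniformizer R ^ (m + 3) ∣ D.t) :
    distinctRootCount (C (redCoeff (D • W).a₂ 1) * X ^ 2 + C (redCoeff (D • W).a₄ (m + 3)) * X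
        + C (redCoeff (D • W).a₆ (2 * m + 5))) =
      distinctRootCount (C (redCoeff W.a₂ 1) * X ^ 2 + C (redCoeff W.a₄ (m + 3)) * X
        + C (redCoeff W.a₆ (2 * m + 5))) := by
  have hϖ : Irreducible (uniformizer R) := irreducible_uniformizer
  have hres0 : residue R (uniformizer R) = 0 := residue_uniformizer_eq_zero hϖ
  set ϖ := uniformizer R with hϖdef
  obtain ⟨α, hα⟩ := h1
  obtain ⟨β, hβ⟩ := h2
  obtain ⟨γ, hγ⟩ := h3
  obtain ⟨δ, hδ⟩ := h4
  obtain ⟨ε, hε⟩ := h6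
  obtain ⟨ρ, hρ⟩ := hr
  obtain ⟨σ, hσ⟩ := hs
  obtain ⟨τ, hτ⟩ := ht
  have c2 : redCoeff (D • W).a₂ 1 = residue R β := by
    have e : (D • W).a₂ = ϖ * (β + ϖ * (3 * ϖ ^ m * ρ - σ * α - σ ^ 2)) := by
      rw [smul_a₂_of_u_eq_one hu, hα, hβ, hρ, hσ]; ring
    rw [e, redCoeff_uniformizer_mul]
    simp only [map_add, map_mul, hres0, zero_mul, add_zero]
  have c4 : redCoeff (D • W).a₄ (m + 3) = residue R δ + 2 * residue R β * residue R ρ := by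
    have e : (D • W).a₄ = ϖ ^ (m + 3) * (δ + 2 * β * ρ
        + ϖ * (3 * ϖ ^ m * ρ ^ 2 - σ * γ - τ * α - ρ * σ * α - 2 * σ * τ)) := by
      rw [smul_a₄_of_u_eq_one hu, hα, hβ, hγ, hδ, hρ, hσ, hτ]; ring
    rw [e, redCoeff_uniformizer_pow_mul]
    simp only [map_add, map_mul, map_ofNat, hres0, zero_mul, add_zero]
  have c6 : redCoeff (D • W).a₆ (2 * m + 5) =
      residue R ε + residue R δ * residue R ρ + residue R β * residue R ρ ^ 2 := by
    have e : (D • W).a₆ = ϖ ^ (2 * m + 5) * (ε + δ * ρ + β * ρ ^ 2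
        + ϖ * (ϖ ^ m * ρ ^ 3 - τ * γ - τ ^ 2 - ρ * τ * α)) := by
      rw [smul_a₆_of_u_eq_one hu, hα, hβ, hγ, hδ, hε, hρ, hτ]; ring
    rw [e, redCoeff_uniformizer_pow_mul]
    simp only [map_add, map_mul, map_pow, hres0, zero_mul, add_zero]
  have w2 : redCoeff W.a₂ 1 = residue R β := by rw [hβ, redCoeff_uniformizer_mul]
  have w4 : redCoeff W.a₄ (m + 3) = residue R δ := by rw [hδ, redCoeff_uniformizer_pow_mul]
  have w6 : redCoeff W.a₆ (2 * m + 5) = residue R ε := by rw [hε, redCoeff_uniformizer_pow_mul]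
  rw [c2, c4, c6, w2, w4, w6, ← quadratic_comp_X_add_C, distinctRootCount_comp_X_add_C]

/-! #### Rescalings: the auxiliary polynomials are twisted by powers of `ū` -/

/-- Residue of the inverse of a unit is nonzero. [folklore] -/
theorem residue_units_inv_ne_zero (u : Rˣ) : residue R ↑u⁻¹ ≠ 0 :=
  (residue_ne_zero_iff_isUnit _).mpr (Units.isUnit u⁻¹)

/-- Step 6/7 cubic tests under a rescaling `(u; 0, 0, 0)` of a step-6 normalised model: the
coefficients `a₂,₁, a₄,₂, a₆,₃` become `ū⁻² a₂,₁, ū⁻⁴ a₄,₂, ū⁻⁶ a₆,₃`, the discriminant is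
multiplied by `ū⁻¹²` and `p² − 3q` by `ū⁻⁴`, so "three distinct roots" and "two distinct roots"
are unchanged. Silverman ATAEC IV.9.4, Steps 6–7. [cite: SilvermanATAEC1994, IV.9.4 Steps 6–7] -/
theorem distinctRootCount_cubicStep6_rescale (u : Rˣ) {W : WeierstrassCurve R}
    (h2 : uniformizer R ∣ W.a₂) (h4 : uniformizer R ^ 2 ∣ W.a₄) (h6 : uniformizer R ^ 3 ∣ W.a₆) :
    (distinctRootCount (cubicStep6 ((⟨u, 0, 0, 0⟩ : WeierstrassCurve.VariableChange R) • W)) = 3 ↔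
        distinctRootCount (cubicStep6 W) = 3) ∧
      (distinctRootCount (cubicStep6 ((⟨u, 0, 0, 0⟩ : WeierstrassCurve.VariableChange R) • W)) = 2 ↔
        distinctRootCount (cubicStep6 W) = 2) := by
  set ϖ := uniformizer R with hϖdef
  set v := residue R ↑u⁻¹ with hv
  have hv0 : v ≠ 0 := residue_units_inv_ne_zero u
  obtain ⟨β, hβ⟩ := h2
  obtain ⟨δ, hδ⟩ := h4
  obtain ⟨ε, hε⟩ := h6
  set E : WeierstrassCurve.VariableChange R := ⟨u, 0, 0, 0⟩ with hE
  have c2 : redCoeff (E • W).a₂ 1 = v ^ 2 * residue R β := by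
    have e : (E • W).a₂ = ϖ * (↑u⁻¹ ^ 2 * β) := by rw [rescale_a₂, hβ]; ring
    rw [e, redCoeff_uniformizer_mul, map_mul, map_pow]
  have c4 : redCoeff (E • W).a₄ 2 = v ^ 4 * residue R δ := by
    have e : (E • W).a₄ = ϖ ^ 2 * (↑u⁻¹ ^ 4 * δ) := by rw [rescale_a₄, hδ]; ring
    rw [e, redCoeff_uniformizer_pow_mul, map_mul, map_pow]
  have c6 : redCoeff (E • W).a₆ 3 = v ^ 6 * residue R ε := by
    have e : (E • W).a₆ = ϖ ^ 3 * (↑u⁻¹ ^ 6 * ε) := by rw [rescale_a₆, hε]; ring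
    rw [e, redCoeff_uniformizer_pow_mul, map_mul, map_pow]
  have w2 : redCoeff W.a₂ 1 = residue R β := by rw [hβ, redCoeff_uniformizer_mul]
  have w4 : redCoeff W.a₄ 2 = residue R δ := by rw [hδ, redCoeff_uniformizer_pow_mul]
  have w6 : redCoeff W.a₆ 3 = residue R ε := by rw [hε, redCoeff_uniformizer_pow_mul]
  set p := residue R β
  set q := residue R δ
  set r := residue R ε
  have hdisc : (v ^ 2 * p) ^ 2 * (v ^ 4 * q) ^ 2 - 4 * (v ^ 4 * q) ^ 3
      - 4 * (v ^ 2 * p) ^ 3 * (v ^ 6 * r) - 27 * (v ^ 6 * r) ^ 2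
      + 18 * (v ^ 2 * p) * (v ^ 4 * q) * (v ^ 6 * r) =
      v ^ 12 * (p ^ 2 * q ^ 2 - 4 * q ^ 3 - 4 * p ^ 3 * r - 27 * r ^ 2 + 18 * p * q * r) := by
    ring
  have hpq : (v ^ 2 * p) ^ 2 - 3 * (v ^ 4 * q) = v ^ 4 * (p ^ 2 - 3 * q) := by ring
  have h3 : distinctRootCount (cubicStep6 (E • W)) = 3 ↔ distinctRootCount (cubicStep6 W) = 3 := by
    rw [cubicStep6, cubicStep6, c2, c4, c6, w2, w4, w6, distinctRootCount_cubic_eq_three_iff,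
      distinctRootCount_cubic_eq_three_iff, hdisc, mul_ne_zero_iff, and_iff_right (pow_ne_zero _ hv0)]
  refine ⟨h3, ?_⟩
  by_cases hd : p ^ 2 * q ^ 2 - 4 * q ^ 3 - 4 * p ^ 3 * r - 27 * r ^ 2 + 18 * p * q * r = 0
  · rw [cubicStep6, cubicStep6, c2, c4, c6, w2, w4, w6,
      distinctRootCount_cubic_eq_two_iff _ _ _ (by rw [hdisc, hd, mul_zero]),
      distinctRootCount_cubic_eq_two_iff _ _ _ hd, hpq, mul_ne_zero_iff,
      and_iff_right (pow_ne_zero _ hv0)]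
  · have hW : distinctRootCount (cubicStep6 W) = 3 := by
      rw [cubicStep6, w2, w4, w6, distinctRootCount_cubic_eq_three_iff]; exact hd
    rw [h3.mpr hW, hW]

/-- Step 7 first quadratic (and step-8 quadratic) test under a rescaling `(u; 0, 0, 0)`:
`a₃,ₘ₊₂ ↦ ū⁻³ a₃,ₘ₊₂`, `a₆,₂ₘ₊₄ ↦ ū⁻⁶ a₆,₂ₘ₊₄`, so `a² + 4c` is multiplied by `ū⁻⁶`.
Silverman ATAEC IV.9.4, Steps 7–9. [cite: SilvermanATAEC1994, IV.9.4 Steps 7–9] -/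
theorem distinctRootCount_quadratic₁_rescale (u : Rˣ) {W : WeierstrassCurve R} {m : ℕ}
    (h3 : uniformizer R ^ (m + 2) ∣ W.a₃) (h6 : uniformizer R ^ (2 * m + 4) ∣ W.a₆) :
    distinctRootCount (X ^ 2
        + C (redCoeff ((⟨u, 0, 0, 0⟩ : WeierstrassCurve.VariableChange R) • W).a₃ (m + 2)) * X
        - C (redCoeff ((⟨u, 0, 0, 0⟩ : WeierstrassCurve.VariableChange R) • W).a₆ (2 * m + 4)))
        = 2 ↔
      distinctRootCount (X ^ 2 + C (redCoeff W.a₃ (m + 2)) * X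
        - C (redCoeff W.a₆ (2 * m + 4))) = 2 := by
  set ϖ := uniformizer R with hϖdef
  set v := residue R ↑u⁻¹ with hv
  have hv0 : v ≠ 0 := residue_units_inv_ne_zero u
  obtain ⟨γ, hγ⟩ := h3
  obtain ⟨ε, hε⟩ := h6
  set E : WeierstrassCurve.VariableChange R := ⟨u, 0, 0, 0⟩ with hE
  have c3 : redCoeff (E • W).a₃ (m + 2) = v ^ 3 * residue R γ := by
    have e : (E • W).a₃ = ϖ ^ (m + 2) * (↑u⁻¹ ^ 3 * γ) := by rw [rescale_a₃, hγ]; ring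
    rw [e, redCoeff_uniformizer_pow_mul, map_mul, map_pow]
  have c6 : redCoeff (E • W).a₆ (2 * m + 4) = v ^ 6 * residue R ε := by
    have e : (E • W).a₆ = ϖ ^ (2 * m + 4) * (↑u⁻¹ ^ 6 * ε) := by rw [rescale_a₆, hε]; ring
    rw [e, redCoeff_uniformizer_pow_mul, map_mul, map_pow]
  have w3 : redCoeff W.a₃ (m + 2) = residue R γ := by rw [hγ, redCoeff_uniformizer_pow_mul]
  have w6 : redCoeff W.a₆ (2 * m + 4) = residue R ε := by rw [hε, redCoeff_uniformizer_pow_mul]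
  have e : (v ^ 3 * residue R γ) ^ 2 + 4 * (v ^ 6 * residue R ε) =
      v ^ 6 * (residue R γ ^ 2 + 4 * residue R ε) := by ring
  rw [c3, c6, w3, w6, distinctRootCount_sq_add_sub_eq_two_iff,
    distinctRootCount_sq_add_sub_eq_two_iff, e, mul_ne_zero_iff, and_iff_right (pow_ne_zero _ hv0)]

/-- Step 7 second quadratic test under a rescaling `(u; 0, 0, 0)` (with `π ∥ a₂`):
`(a₂,₁, a₄,ₘ₊₃, a₆,₂ₘ₊₅) ↦ (ū⁻² a₂,₁, ū⁻⁴ a₄,ₘ₊₃, ū⁻⁶ a₆,₂ₘ₊₅)`, so `b² − 4ac` is multiplied by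
`ū⁻⁸`. Silverman ATAEC IV.9.4, Step 7. [cite: SilvermanATAEC1994, IV.9.4 Step 7] -/
theorem distinctRootCount_quadratic₂_rescale (u : Rˣ) {W : WeierstrassCurve R} {m : ℕ}
    (h2 : uniformizer R ∣ W.a₂) (h2n : ¬ uniformizer R ^ 2 ∣ W.a₂)
    (h4 : uniformizer R ^ (m + 3) ∣ W.a₄) (h6 : uniformizer R ^ (2 * m + 5) ∣ W.a₆) :
    distinctRootCount
        (C (redCoeff ((⟨u, 0, 0, 0⟩ : WeierstrassCurve.VariableChange R) • W).a₂ 1) * X ^ 2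
        + C (redCoeff ((⟨u, 0, 0, 0⟩ : WeierstrassCurve.VariableChange R) • W).a₄ (m + 3)) * X
        + C (redCoeff ((⟨u, 0, 0, 0⟩ : WeierstrassCurve.VariableChange R) • W).a₆ (2 * m + 5)))
        = 2 ↔
      distinctRootCount (C (redCoeff W.a₂ 1) * X ^ 2 + C (redCoeff W.a₄ (m + 3)) * X
        + C (redCoeff W.a₆ (2 * m + 5))) = 2 := by
  have hϖ : Irreducible (uniformizer R) := irreducible_uniformizer
  set ϖ := uniformizer R with hϖdef
  set v := residue R ↑u⁻¹ with hv
  have hv0 : v ≠ 0 := residue_units_inv_ne_zero u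
  obtain ⟨β, hβ⟩ := h2
  have hβ0 : residue R β ≠ 0 := by
    intro h
    apply h2n
    obtain ⟨β', hβ'⟩ := (dvd_iff_residue_eq_zero hϖ β).mpr h
    exact ⟨β', by rw [hβ, hβ']; ring⟩
  obtain ⟨δ, hδ⟩ := h4
  obtain ⟨ε, hε⟩ := h6
  set E : WeierstrassCurve.VariableChange R := ⟨u, 0, 0, 0⟩ with hE
  have c2 : redCoeff (E • W).a₂ 1 = v ^ 2 * residue R β := by
    have e : (E • W).a₂ = ϖ * (↑u⁻¹ ^ 2 * β) := by rw [rescale_a₂, hβ]; ring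
    rw [e, redCoeff_uniformizer_mul, map_mul, map_pow]
  have c4 : redCoeff (E • W).a₄ (m + 3) = v ^ 4 * residue R δ := by
    have e : (E • W).a₄ = ϖ ^ (m + 3) * (↑u⁻¹ ^ 4 * δ) := by rw [rescale_a₄, hδ]; ring
    rw [e, redCoeff_uniformizer_pow_mul, map_mul, map_pow]
  have c6 : redCoeff (E • W).a₆ (2 * m + 5) = v ^ 6 * residue R ε := by
    have e : (E • W).a₆ = ϖ ^ (2 * m + 5) * (↑u⁻¹ ^ 6 * ε) := by rw [rescale_a₆, hε]; ring
    rw [e, redCoeff_uniformizer_pow_mul, map_mul, map_pow]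
  have w2 : redCoeff W.a₂ 1 = residue R β := by rw [hβ, redCoeff_uniformizer_mul]
  have w4 : redCoeff W.a₄ (m + 3) = residue R δ := by rw [hδ, redCoeff_uniformizer_pow_mul]
  have w6 : redCoeff W.a₆ (2 * m + 5) = residue R ε := by rw [hε, redCoeff_uniformizer_pow_mul]
  have e : (v ^ 4 * residue R δ) ^ 2 - 4 * (v ^ 2 * residue R β) * (v ^ 6 * residue R ε) =
      v ^ 8 * (residue R δ ^ 2 - 4 * residue R β * residue R ε) := by ring
  rw [c2, c4, c6, w2, w4, w6,
    distinctRootCount_quadratic_eq_two_iff_ne_zero (mul_ne_zero (pow_ne_zero _ hv0) hβ0),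
    distinctRootCount_quadratic_eq_two_iff_ne_zero hβ0, e, mul_ne_zero_iff,
    and_iff_right (pow_ne_zero _ hv0)]

end PolyTests

/-! ### Existence of the normalising changes of variables over a perfect residue field

The existence statements are those of `Literature…TateAlgorithmTranslationsProofs`
(`exists_variableChange_step2_of_perfectField`, `…step6/7/8/9_of_perfectField`,
`…istarA/B_of_perfectField`); the coupling argument below consumes them with divisibility
hypotheses `π ^ k ∣ aᵢ`, so we record the (definitionally trivial) translations
(`IsDiscreteValuationRing.mem_maximalIdeal_(pow_)iff_dvd`). -/

section Existence

variable {R : Type*} [CommRing R] [IsDomain R] [IsDiscreteValuationRing R]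
  [PerfectField (ResidueField R)]

/-- Step 6 normalisation exists (perfect residue field), divisibility form of
`exists_variableChange_step6_of_perfectField`. Silverman ATAEC IV.9.4, Step 6.
[cite: SilvermanATAEC1994, IV.9.4 Step 6] -/
theorem exists_variableChange_step6_of_dvd {V : WeierstrassCurve R} (h3 : uniformizer R ∣ V.a₃)
    (h4 : uniformizer R ∣ V.a₄) (h6 : uniformizer R ^ 2 ∣ V.a₆) (hb₂ : uniformizer R ∣ V.b₂)
    (hb₆ : uniformizer R ^ 3 ∣ V.b₆) (hb₈ : uniformizer R ^ 3 ∣ V.b₈) :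
    ∃ C : WeierstrassCurve.VariableChange R, C.u = 1 ∧
      (C • V).a₁ ∈ maximalIdeal R ∧ (C • V).a₂ ∈ maximalIdeal R ∧
      (C • V).a₃ ∈ maximalIdeal R ^ 2 ∧ (C • V).a₄ ∈ maximalIdeal R ^ 2 ∧
      (C • V).a₆ ∈ maximalIdeal R ^ 3 :=
  exists_variableChange_step6_of_perfectField (mem_maximalIdeal_iff_dvd.mpr hb₂)
    (mem_maximalIdeal_iff_dvd.mpr h3) (mem_maximalIdeal_iff_dvd.mpr h4)
    (mem_maximalIdeal_pow_iff_dvd.mpr h6) (mem_maximalIdeal_pow_iff_dvd.mpr hb₆)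
    (mem_maximalIdeal_pow_iff_dvd.mpr hb₈)

/-- Step 7 normalisation exists (perfect residue field, the cubic has a rational double root),
divisibility form of `exists_variableChange_step7_of_perfectField`. Silverman ATAEC IV.9.4, Step 7.
[cite: SilvermanATAEC1994, IV.9.4 Step 7] -/
theorem exists_variableChange_step7_of_dvd {V : WeierstrassCurve R}
    (h1 : uniformizer R ∣ V.a₁) (h2 : uniformizer R ∣ V.a₂) (h3 : uniformizer R ^ 2 ∣ V.a₃)
    (h4 : uniformizer R ^ 2 ∣ V.a₄) (h6 : uniformizer R ^ 3 ∣ V.a₆)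
    (h7 : distinctRootCount (cubicStep6 V) = 2) :
    ∃ C : WeierstrassCurve.VariableChange R, C.u = 1 ∧
      (C • V).a₁ ∈ maximalIdeal R ∧ (C • V).a₂ ∈ maximalIdeal R ∧
      (C • V).a₃ ∈ maximalIdeal R ^ 2 ∧ (C • V).a₄ ∈ maximalIdeal R ^ 3 ∧
      (C • V).a₆ ∈ maximalIdeal R ^ 4 :=
  exists_variableChange_step7_of_perfectField (mem_maximalIdeal_iff_dvd.mpr h1)
    (mem_maximalIdeal_iff_dvd.mpr h2) (mem_maximalIdeal_pow_iff_dvd.mpr h3)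
    (mem_maximalIdeal_pow_iff_dvd.mpr h4) (mem_maximalIdeal_pow_iff_dvd.mpr h6) h7

/-- Step 8 normalisation exists (perfect residue field, the cubic has a rational triple root),
divisibility form of `exists_variableChange_step8_of_perfectField`. Silverman ATAEC IV.9.4, Step 8.
[cite: SilvermanATAEC1994, IV.9.4 Step 8] -/
theorem exists_variableChange_step8_of_dvd {V : WeierstrassCurve R}
    (h1 : uniformizer R ∣ V.a₁) (h2 : uniformizer R ∣ V.a₂) (h3 : uniformizer R ^ 2 ∣ V.a₃)
    (h4 : uniformizer R ^ 2 ∣ V.a₄) (h6 : uniformizer R ^ 3 ∣ V.a₆)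
    (hne3 : distinctRootCount (cubicStep6 V) ≠ 3) (hne2 : distinctRootCount (cubicStep6 V) ≠ 2) :
    ∃ C : WeierstrassCurve.VariableChange R, C.u = 1 ∧
      (C • V).a₁ ∈ maximalIdeal R ∧ (C • V).a₂ ∈ maximalIdeal R ^ 2 ∧
      (C • V).a₃ ∈ maximalIdeal R ^ 2 ∧ (C • V).a₄ ∈ maximalIdeal R ^ 3 ∧
      (C • V).a₆ ∈ maximalIdeal R ^ 4 :=
  exists_variableChange_step8_of_perfectField (mem_maximalIdeal_iff_dvd.mpr h1)
    (mem_maximalIdeal_iff_dvd.mpr h2) (mem_maximalIdeal_pow_iff_dvd.mpr h3)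
    (mem_maximalIdeal_pow_iff_dvd.mpr h4) (mem_maximalIdeal_pow_iff_dvd.mpr h6) hne3 hne2

/-- Step 9 normalisation exists (perfect residue field, the step-8 quadratic has a rational double
root), divisibility form of `exists_variableChange_step9_of_perfectField`.
Silverman ATAEC IV.9.4, Step 9. [cite: SilvermanATAEC1994, IV.9.4 Step 9] -/
theorem exists_variableChange_step9_of_dvd {V : WeierstrassCurve R}
    (h1 : uniformizer R ∣ V.a₁) (h2 : uniformizer R ^ 2 ∣ V.a₂) (h3 : uniformizer R ^ 2 ∣ V.a₃)
    (h4 : uniformizer R ^ 3 ∣ V.a₄) (h6 : uniformizer R ^ 4 ∣ V.a₆)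
    (hne : distinctRootCount (quadraticStep8 V) ≠ 2) :
    ∃ C : WeierstrassCurve.VariableChange R, C.u = 1 ∧
      (C • V).a₁ ∈ maximalIdeal R ∧ (C • V).a₂ ∈ maximalIdeal R ^ 2 ∧
      (C • V).a₃ ∈ maximalIdeal R ^ 3 ∧ (C • V).a₄ ∈ maximalIdeal R ^ 3 ∧
      (C • V).a₆ ∈ maximalIdeal R ^ 5 :=
  exists_variableChange_step9_of_perfectField (mem_maximalIdeal_iff_dvd.mpr h1)
    (mem_maximalIdeal_pow_iff_dvd.mpr h2) (mem_maximalIdeal_pow_iff_dvd.mpr h3)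
    (mem_maximalIdeal_pow_iff_dvd.mpr h4) (mem_maximalIdeal_pow_iff_dvd.mpr h6) hne

end Existence

/-! ### Coupling two runs of the algorithm -/

section CouplingRing

variable {R : Type*} [CommRing R]

/-- If `W' = D • W`, `W₁ = C • W`, `W₁' = C' • W'` then `W₁' = (C' D C⁻¹) • W₁`. [folklore] -/
theorem smul_eq_conj_smul {W W' W₁ W₁' : WeierstrassCurve R}
    {D C C' : WeierstrassCurve.VariableChange R} (hrel : W' = D • W) (h₁ : W₁ = C • W)
    (h₁' : W₁' = C' • W') : W₁' = (C' * D * C⁻¹) • W₁ := by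
  rw [h₁', hrel, h₁, mul_smul, mul_smul, inv_smul_smul]

/-- `D • W = (u; 0, 0, 0) • ((1; r, s, t) • W)`. [folklore] -/
theorem smul_eq_rescale_smul (D : WeierstrassCurve.VariableChange R) (W : WeierstrassCurve R) :
    D • W = (⟨D.u, 0, 0, 0⟩ : WeierstrassCurve.VariableChange R) •
      ((⟨1, D.r, D.s, D.t⟩ : WeierstrassCurve.VariableChange R) • W) := by
  rw [← mul_smul, ← VariableChange.eq_rescale_mul_of_u D]

/-- Divisibility of `a₁` is unchanged by a rescaling. [folklore] -/
theorem dvd_rescale_a₁_iff (u : Rˣ) (W : WeierstrassCurve R) (d : R) :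
    d ∣ ((⟨u, 0, 0, 0⟩ : WeierstrassCurve.VariableChange R) • W).a₁ ↔ d ∣ W.a₁ := by
  rw [rescale_a₁]; exact (Units.isUnit u⁻¹).dvd_mul_left

/-- Divisibility of `a₂` is unchanged by a rescaling. [folklore] -/
theorem dvd_rescale_a₂_iff (u : Rˣ) (W : WeierstrassCurve R) (d : R) :
    d ∣ ((⟨u, 0, 0, 0⟩ : WeierstrassCurve.VariableChange R) • W).a₂ ↔ d ∣ W.a₂ := by
  rw [rescale_a₂]; exact ((Units.isUnit u⁻¹).pow 2).dvd_mul_left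

/-- Divisibility of `a₃` is unchanged by a rescaling. [folklore] -/
theorem dvd_rescale_a₃_iff (u : Rˣ) (W : WeierstrassCurve R) (d : R) :
    d ∣ ((⟨u, 0, 0, 0⟩ : WeierstrassCurve.VariableChange R) • W).a₃ ↔ d ∣ W.a₃ := by
  rw [rescale_a₃]; exact ((Units.isUnit u⁻¹).pow 3).dvd_mul_left

/-- Divisibility of `a₄` is unchanged by a rescaling. [folklore] -/
theorem dvd_rescale_a₄_iff (u : Rˣ) (W : WeierstrassCurve R) (d : R) :
    d ∣ ((⟨u, 0, 0, 0⟩ : WeierstrassCurve.VariableChange R) • W).a₄ ↔ d ∣ W.a₄ := by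
  rw [rescale_a₄]; exact ((Units.isUnit u⁻¹).pow 4).dvd_mul_left

/-- Divisibility of `a₆` is unchanged by a rescaling. [folklore] -/
theorem dvd_rescale_a₆_iff (u : Rˣ) (W : WeierstrassCurve R) (d : R) :
    d ∣ ((⟨u, 0, 0, 0⟩ : WeierstrassCurve.VariableChange R) • W).a₆ ↔ d ∣ W.a₆ := by
  rw [rescale_a₆]; exact ((Units.isUnit u⁻¹).pow 6).dvd_mul_left

/-- Divisibility of `b₂` is unchanged by a rescaling. [folklore] -/
theorem dvd_rescale_b₂_iff (u : Rˣ) (W : WeierstrassCurve R) (d : R) :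
    d ∣ ((⟨u, 0, 0, 0⟩ : WeierstrassCurve.VariableChange R) • W).b₂ ↔ d ∣ W.b₂ := by
  rw [rescale_b₂]; exact ((Units.isUnit u⁻¹).pow 2).dvd_mul_left

/-- Divisibility of `b₆` is unchanged by a rescaling. [folklore] -/
theorem dvd_rescale_b₆_iff (u : Rˣ) (W : WeierstrassCurve R) (d : R) :
    d ∣ ((⟨u, 0, 0, 0⟩ : WeierstrassCurve.VariableChange R) • W).b₆ ↔ d ∣ W.b₆ := by
  rw [rescale_b₆]; exact ((Units.isUnit u⁻¹).pow 6).dvd_mul_left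

/-- Divisibility of `b₈` is unchanged by a rescaling. [folklore] -/
theorem dvd_rescale_b₈_iff (u : Rˣ) (W : WeierstrassCurve R) (d : R) :
    d ∣ ((⟨u, 0, 0, 0⟩ : WeierstrassCurve.VariableChange R) • W).b₈ ↔ d ∣ W.b₈ := by
  rw [rescale_b₈]; exact ((Units.isUnit u⁻¹).pow 8).dvd_mul_left

/-- Divisibility of `Δ` is unchanged by any change of variables over `R`. [folklore] -/
theorem dvd_Δ_smul_iff (D : WeierstrassCurve.VariableChange R) (W : WeierstrassCurve R) (d : R) :
    d ∣ (D • W).Δ ↔ d ∣ W.Δ := by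
  rw [WeierstrassCurve.variableChange_Δ]; exact ((Units.isUnit D.u⁻¹).pow 12).dvd_mul_left

end CouplingRing

section Coupling

variable {R : Type*} [CommRing R] [IsDomain R] [IsDiscreteValuationRing R]

/-- `ord Δ` is unchanged by any change of variables over `R`. [folklore] -/
theorem addVal_Δ_smul_toNat (D : WeierstrassCurve.VariableChange R) (W : WeierstrassCurve R) :
    (IsDiscreteValuationRing.addVal R (D • W).Δ).toNat =
      (IsDiscreteValuationRing.addVal R W.Δ).toNat := by
  rw [WeierstrassCurve.variableChange_Δ, IsDiscreteValuationRing.addVal_mul,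
    IsDiscreteValuationRing.addVal_eq_zero_iff.mpr ((Units.isUnit D.u⁻¹).pow 12), zero_add]

/-- `π² ∣ a₂` is unchanged under a `u = 1` change with `π² ∣ r`, `π ∣ s` when `π ∣ a₁`
(so `π ∥ a₂` is preserved along the `Iₙ*` sub-procedure). [folklore] -/
theorem sq_dvd_a₂_smul_iff {W : WeierstrassCurve R} {D : WeierstrassCurve.VariableChange R}
    (hu : D.u = 1) (h1 : uniformizer R ∣ W.a₁) (hr : uniformizer R ^ 2 ∣ D.r)
    (hs : uniformizer R ∣ D.s) : uniformizer R ^ 2 ∣ (D • W).a₂ ↔ uniformizer R ^ 2 ∣ W.a₂ := by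
  set ϖ := uniformizer R
  obtain ⟨α, hα⟩ := h1
  obtain ⟨ρ, hρ⟩ := hr
  obtain ⟨σ, hσ⟩ := hs
  have e : (D • W).a₂ = W.a₂ + ϖ ^ 2 * (-(σ * α) + 3 * ρ - σ ^ 2) := by
    rw [smul_a₂_of_u_eq_one hu, hα, hρ, hσ]; ring
  rw [e]
  exact dvd_add_left (dvd_mul_right _ _)

/-- On a round-`0` normalised model of step 7 (`π³ ∣ a₄`, `π⁴ ∣ a₆`) whose cubic
`T³ + a₂,₁ T²` has exactly two distinct roots, `a₂,₁ ≠ 0`, i.e. `π² ∤ a₂`. Silverman ATAEC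
IV.9.4, Step 7 ("`π² ∤ a₂`"). [cite: SilvermanATAEC1994, IV.9.4 Step 7] -/
theorem not_sq_dvd_a₂_of_distinctRootCount_eq_two {V : WeierstrassCurve R}
    (h4 : uniformizer R ^ 3 ∣ V.a₄) (h6 : uniformizer R ^ 4 ∣ V.a₆)
    (h : distinctRootCount (cubicStep6 V) = 2) : ¬ uniformizer R ^ 2 ∣ V.a₂ := by
  intro h2
  rw [cubicStep6, redCoeff_eq_zero_of_dvd (j := 1) (by simpa using h2), redCoeff_eq_zero_of_dvd h4,
    redCoeff_eq_zero_of_dvd h6] at h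
  exact ((distinctRootCount_cubic_eq_two_iff (0 : ResidueField R) 0 0 (by ring)).mp h) (by ring)

end Coupling

/-! ### Step 7: the `Iₙ*` sub-procedure is well defined -/

section Step7

variable {R : Type*} [CommRing R] [IsDomain R] [IsDiscreteValuationRing R]

/-- Existence of the `y`-translation of the sub-procedure, in the form tested by `istarIndexAux`.
[cite: SilvermanATAEC1994, IV.9.4 Step 7] -/
theorem exists_normalize_istarA [PerfectField (ResidueField R)] {m : ℕ} {W : WeierstrassCurve R}
    (h1 : uniformizer R ∣ W.a₁) (h2 : uniformizer R ∣ W.a₂) (h3 : uniformizer R ^ (m + 2) ∣ W.a₃)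
    (h4 : uniformizer R ^ (m + 3) ∣ W.a₄) (h6 : uniformizer R ^ (2 * m + 4) ∣ W.a₆)
    (hne : distinctRootCount
      (X ^ 2 + C (redCoeff W.a₃ (m + 2)) * X - C (redCoeff W.a₆ (2 * m + 4))) ≠ 2) :
    ∃ C : WeierstrassCurve.VariableChange R, C.u = 1 ∧
      (C • W).a₁ ∈ maximalIdeal R ∧ (C • W).a₂ ∈ maximalIdeal R ∧
      (C • W).a₃ ∈ maximalIdeal R ^ (m + 3) ∧ (C • W).a₄ ∈ maximalIdeal R ^ (m + 3) ∧
      (C • W).a₆ ∈ maximalIdeal R ^ (2 * m + 5) :=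
  exists_variableChange_istarA_of_perfectField (mem_maximalIdeal_iff_dvd.mpr h1)
    (mem_maximalIdeal_iff_dvd.mpr h2) (mem_maximalIdeal_pow_iff_dvd.mpr h3)
    (mem_maximalIdeal_pow_iff_dvd.mpr h4) (mem_maximalIdeal_pow_iff_dvd.mpr h6) hne

/-- Existence of the `x`-translation of the sub-procedure, in the form tested by `istarIndexAux`.
[cite: SilvermanATAEC1994, IV.9.4 Step 7] -/
theorem exists_normalize_istarB [PerfectField (ResidueField R)] {m : ℕ} {W : WeierstrassCurve R}
    (h1 : uniformizer R ∣ W.a₁) (h2 : uniformizer R ∣ W.a₂) (h2n : ¬ uniformizer R ^ 2 ∣ W.a₂)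
    (h3 : uniformizer R ^ (m + 3) ∣ W.a₃) (h4 : uniformizer R ^ (m + 3) ∣ W.a₄)
    (h6 : uniformizer R ^ (2 * m + 5) ∣ W.a₆)
    (hne : distinctRootCount (C (redCoeff W.a₂ 1) * X ^ 2 + C (redCoeff W.a₄ (m + 3)) * X
      + C (redCoeff W.a₆ (2 * m + 5))) ≠ 2) :
    ∃ C : WeierstrassCurve.VariableChange R, C.u = 1 ∧
      (C • W).a₁ ∈ maximalIdeal R ∧ (C • W).a₂ ∈ maximalIdeal R ∧
      (C • W).a₃ ∈ maximalIdeal R ^ (m + 3) ∧ (C • W).a₄ ∈ maximalIdeal R ^ (m + 4) ∧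
      (C • W).a₆ ∈ maximalIdeal R ^ (2 * m + 6) :=
  exists_variableChange_istarB_of_perfectField (mem_maximalIdeal_iff_dvd.mpr h1)
    (mem_maximalIdeal_iff_dvd.mpr h2) (fun h => h2n (mem_maximalIdeal_pow_iff_dvd.mp h))
    (mem_maximalIdeal_pow_iff_dvd.mpr h3) (mem_maximalIdeal_pow_iff_dvd.mpr h4)
    (mem_maximalIdeal_pow_iff_dvd.mpr h6) hne

/-- Bookkeeping after the `y`-translation: the new model is normalised for the second half of
round `m` and still has `π ∥ a₂` (rigidity `dvd_r_s_t_of_step7`). [folklore] -/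
theorem istarA_spec {m : ℕ} {W : WeierstrassCurve R} (h1 : uniformizer R ∣ W.a₁)
    (h2 : uniformizer R ∣ W.a₂) (h2n : ¬ uniformizer R ^ 2 ∣ W.a₂)
    (h3 : uniformizer R ^ (m + 2) ∣ W.a₃) (h4 : uniformizer R ^ (m + 3) ∣ W.a₄)
    (h6 : uniformizer R ^ (2 * m + 4) ∣ W.a₆)
    (hex : ∃ C : WeierstrassCurve.VariableChange R, C.u = 1 ∧
      (C • W).a₁ ∈ maximalIdeal R ∧ (C • W).a₂ ∈ maximalIdeal R ∧
      (C • W).a₃ ∈ maximalIdeal R ^ (m + 3) ∧ (C • W).a₄ ∈ maximalIdeal R ^ (m + 3) ∧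
      (C • W).a₆ ∈ maximalIdeal R ^ (2 * m + 5)) :
    uniformizer R ∣ (hex.choose • W).a₁ ∧ uniformizer R ∣ (hex.choose • W).a₂ ∧
      ¬ uniformizer R ^ 2 ∣ (hex.choose • W).a₂ ∧
      uniformizer R ^ (m + 3) ∣ (hex.choose • W).a₃ ∧ uniformizer R ^ (m + 3) ∣ (hex.choose • W).a₄ ∧
      uniformizer R ^ (2 * m + 5) ∣ (hex.choose • W).a₆ := by
  set ϖ := uniformizer R
  obtain ⟨hu, m1, m2, m3, m4, m6⟩ := hex.choose_spec
  have k1 := mem_maximalIdeal_iff_dvd.mp m1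
  have k2 := mem_maximalIdeal_iff_dvd.mp m2
  have k3 := mem_maximalIdeal_pow_iff_dvd.mp m3
  have k4 := mem_maximalIdeal_pow_iff_dvd.mp m4
  have k6 := mem_maximalIdeal_pow_iff_dvd.mp m6
  obtain ⟨hr, hs, -⟩ := dvd_r_s_t_of_step7 hu h1 h2 h2n h3 h4 h6 k1 k2
    ((pow_dvd_pow ϖ (by omega : m + 2 ≤ m + 3)).trans k3) k4
    ((pow_dvd_pow ϖ (by omega : 2 * m + 4 ≤ 2 * m + 5)).trans k6)
  have k2n : ¬ ϖ ^ 2 ∣ (hex.choose • W).a₂ := by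
    rw [sq_dvd_a₂_smul_iff hu h1 ((pow_dvd_pow ϖ (by omega : 2 ≤ m + 2)).trans hr) hs]
    exact h2n
  exact ⟨k1, k2, k2n, k3, k4, k6⟩

/-- Bookkeeping after the `x`-translation: the new model is normalised for round `m + 1` and
still has `π ∥ a₂` (rigidity `dvd_r_s_t_of_step7b`). [folklore] -/
theorem istarB_spec {m : ℕ} {W : WeierstrassCurve R} (h1 : uniformizer R ∣ W.a₁)
    (h2 : uniformizer R ∣ W.a₂) (h2n : ¬ uniformizer R ^ 2 ∣ W.a₂)
    (h3 : uniformizer R ^ (m + 3) ∣ W.a₃) (h4 : uniformizer R ^ (m + 3) ∣ W.a₄)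
    (h6 : uniformizer R ^ (2 * m + 5) ∣ W.a₆)
    (hex : ∃ C : WeierstrassCurve.VariableChange R, C.u = 1 ∧
      (C • W).a₁ ∈ maximalIdeal R ∧ (C • W).a₂ ∈ maximalIdeal R ∧
      (C • W).a₃ ∈ maximalIdeal R ^ (m + 3) ∧ (C • W).a₄ ∈ maximalIdeal R ^ (m + 4) ∧
      (C • W).a₆ ∈ maximalIdeal R ^ (2 * m + 6)) :
    uniformizer R ∣ (hex.choose • W).a₁ ∧ uniformizer R ∣ (hex.choose • W).a₂ ∧
      ¬ uniformizer R ^ 2 ∣ (hex.choose • W).a₂ ∧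
      uniformizer R ^ (m + 1 + 2) ∣ (hex.choose • W).a₃ ∧
      uniformizer R ^ (m + 1 + 3) ∣ (hex.choose • W).a₄ ∧
      uniformizer R ^ (2 * (m + 1) + 4) ∣ (hex.choose • W).a₆ := by
  set ϖ := uniformizer R
  obtain ⟨hu, m1, m2, m3, m4, m6⟩ := hex.choose_spec
  have k1 := mem_maximalIdeal_iff_dvd.mp m1
  have k2 := mem_maximalIdeal_iff_dvd.mp m2
  have k3 := mem_maximalIdeal_pow_iff_dvd.mp m3
  have k4 := mem_maximalIdeal_pow_iff_dvd.mp m4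
  have k6 := mem_maximalIdeal_pow_iff_dvd.mp m6
  obtain ⟨hr, hs, -⟩ := dvd_r_s_t_of_step7b hu h1 h2 h2n h3 h4 h6 k1 k2 k3
    ((pow_dvd_pow ϖ (by omega : m + 3 ≤ m + 4)).trans k4)
    ((pow_dvd_pow ϖ (by omega : 2 * m + 5 ≤ 2 * m + 6)).trans k6)
  have k2n : ¬ ϖ ^ 2 ∣ (hex.choose • W).a₂ := by
    rw [sq_dvd_a₂_smul_iff hu h1 ((pow_dvd_pow ϖ (by omega : 2 ≤ m + 2)).trans hr) hs]
    exact h2n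
  refine ⟨k1, k2, k2n, ?_, ?_, ?_⟩
  · exact k3
  · exact k4
  · exact k6

/-- **The `Iₙ*` sub-procedure is well defined** (coupled induction on the fuel): if `W' = D • W`
with `D` a change of variables over `R` and both `W`, `W'` are normalised for the start of round
`m` (`π ∣ a₁`, `π ∥ a₂`, `π^{m+2} ∣ a₃`, `π^{m+3} ∣ a₄`, `π^{2m+4} ∣ a₆`), then `istarIndexAux`
returns the same value on both, whatever normalising translations are chosen along the way:
by rigidity the two runs stay related by changes with `u ∈ Rˣ`, `π^{m+2} ∣ r`, `π ∣ s`,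
`π^{m+2} ∣ t` (resp. `π^{m+3} ∣ t`), under which the tested quadratics are translated and
twisted by units. Silverman ATAEC IV.9.4, Step 7; Tate 1975, §7. [cite: SilvermanATAEC1994, IV.9.4 Step 7] -/
theorem istarIndexAux_smul_eq [PerfectField (ResidueField R)] (fuel : ℕ) :
    ∀ (m : ℕ) {W W' : WeierstrassCurve R} {D : WeierstrassCurve.VariableChange R},
      W' = D • W →
      uniformizer R ∣ W.a₁ → uniformizer R ∣ W.a₂ → ¬ uniformizer R ^ 2 ∣ W.a₂ →
      uniformizer R ^ (m + 2) ∣ W.a₃ → uniformizer R ^ (m + 3) ∣ W.a₄ →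
      uniformizer R ^ (2 * m + 4) ∣ W.a₆ →
      uniformizer R ∣ W'.a₁ → uniformizer R ∣ W'.a₂ → ¬ uniformizer R ^ 2 ∣ W'.a₂ →
      uniformizer R ^ (m + 2) ∣ W'.a₃ → uniformizer R ^ (m + 3) ∣ W'.a₄ →
      uniformizer R ^ (2 * m + 4) ∣ W'.a₆ →
      istarIndexAux fuel m W' = istarIndexAux fuel m W := by
  classical
  set ϖ := uniformizer R with hϖdef
  induction fuel with
  | zero => intros; rw [istarIndexAux_zero, istarIndexAux_zero]
  | succ fuel ih =>
    intro m W W' D hrel h1 h2 h2n h3 h4 h6 h1' h2' h2n' h3' h4' h6'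
    rw [istarIndexAux_succ, istarIndexAux_succ]
    -- factor `D` and rigidity
    set D₀ : WeierstrassCurve.VariableChange R := ⟨1, D.r, D.s, D.t⟩ with hD₀
    have hu₀ : D₀.u = 1 := rfl
    have hfac : W' = (⟨D.u, 0, 0, 0⟩ : WeierstrassCurve.VariableChange R) • (D₀ • W) := by
      rw [hrel, smul_eq_rescale_smul]
    have v1 : ϖ ∣ (D₀ • W).a₁ := (dvd_rescale_a₁_iff D.u _ _).mp (hfac ▸ h1')
    have v2 : ϖ ∣ (D₀ • W).a₂ := (dvd_rescale_a₂_iff D.u _ _).mp (hfac ▸ h2')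
    have v3 : ϖ ^ (m + 2) ∣ (D₀ • W).a₃ := (dvd_rescale_a₃_iff D.u _ _).mp (hfac ▸ h3')
    have v4 : ϖ ^ (m + 3) ∣ (D₀ • W).a₄ := (dvd_rescale_a₄_iff D.u _ _).mp (hfac ▸ h4')
    have v6 : ϖ ^ (2 * m + 4) ∣ (D₀ • W).a₆ := (dvd_rescale_a₆_iff D.u _ _).mp (hfac ▸ h6')
    obtain ⟨hr, hs, ht⟩ := dvd_r_s_t_of_step7 hu₀ h1 h2 h2n h3 h4 h6 v1 v2 v3 v4 v6
    -- first test
    have iffA : distinctRootCount (X ^ 2 + C (redCoeff W'.a₃ (m + 2)) * X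
        - C (redCoeff W'.a₆ (2 * m + 4))) = 2 ↔
        distinctRootCount (X ^ 2 + C (redCoeff W.a₃ (m + 2)) * X
        - C (redCoeff W.a₆ (2 * m + 4))) = 2 := by
      rw [hfac, distinctRootCount_quadratic₁_rescale D.u v3 v6,
        distinctRootCount_quadratic₁_smul hu₀ h1 h2 h3 h4 h6 hr hs ht]
    by_cases hA : distinctRootCount (X ^ 2 + C (redCoeff W.a₃ (m + 2)) * X
        - C (redCoeff W.a₆ (2 * m + 4))) = 2
    · rw [if_pos hA, if_pos (iffA.mpr hA)]
    have hA' := fun h => hA (iffA.mp h)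
    rw [if_neg hA, if_neg hA']
    -- the `y`-translations exist
    have hexA := exists_normalize_istarA h1 h2 h3 h4 h6 hA
    have hexA' := exists_normalize_istarA h1' h2' h3' h4' h6' hA'
    rw [dif_pos hexA, dif_pos hexA']
    simp only []
    obtain ⟨k1, k2, k2n, k3, k4, k6⟩ := istarA_spec h1 h2 h2n h3 h4 h6 hexA
    obtain ⟨k1', k2', k2n', k3', k4', k6'⟩ := istarA_spec h1' h2' h2n' h3' h4' h6' hexA'
    set W₁ := hexA.choose • W with hW₁
    set W₁' := hexA'.choose • W' with hW₁'
    -- coupling of the translated models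
    have hrel₁ : W₁' = (hexA'.choose * D * hexA.choose⁻¹) • W₁ := smul_eq_conj_smul hrel hW₁ hW₁'
    set D₁ := hexA'.choose * D * hexA.choose⁻¹ with hD₁
    set D₁₀ : WeierstrassCurve.VariableChange R := ⟨1, D₁.r, D₁.s, D₁.t⟩ with hD₁₀
    have hu₁₀ : D₁₀.u = 1 := rfl
    have hfac₁ : W₁' = (⟨D₁.u, 0, 0, 0⟩ : WeierstrassCurve.VariableChange R) • (D₁₀ • W₁) := by
      rw [hrel₁, smul_eq_rescale_smul]
    have x1 : ϖ ∣ (D₁₀ • W₁).a₁ := (dvd_rescale_a₁_iff D₁.u _ _).mp (hfac₁ ▸ k1')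
    have x2 : ϖ ∣ (D₁₀ • W₁).a₂ := (dvd_rescale_a₂_iff D₁.u _ _).mp (hfac₁ ▸ k2')
    have x2n : ¬ ϖ ^ 2 ∣ (D₁₀ • W₁).a₂ := fun h =>
      k2n' (hfac₁ ▸ (dvd_rescale_a₂_iff D₁.u (D₁₀ • W₁) (ϖ ^ 2)).mpr h)
    have x3 : ϖ ^ (m + 3) ∣ (D₁₀ • W₁).a₃ := (dvd_rescale_a₃_iff D₁.u _ _).mp (hfac₁ ▸ k3')
    have x4 : ϖ ^ (m + 3) ∣ (D₁₀ • W₁).a₄ := (dvd_rescale_a₄_iff D₁.u _ _).mp (hfac₁ ▸ k4')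
    have x6 : ϖ ^ (2 * m + 5) ∣ (D₁₀ • W₁).a₆ := (dvd_rescale_a₆_iff D₁.u _ _).mp (hfac₁ ▸ k6')
    obtain ⟨hr₁, hs₁, ht₁⟩ := dvd_r_s_t_of_step7b hu₁₀ k1 k2 k2n k3 k4 k6 x1 x2 x3 x4 x6
    -- second test
    have iffB : distinctRootCount (C (redCoeff W₁'.a₂ 1) * X ^ 2 + C (redCoeff W₁'.a₄ (m + 3)) * X
        + C (redCoeff W₁'.a₆ (2 * m + 5))) = 2 ↔
        distinctRootCount (C (redCoeff W₁.a₂ 1) * X ^ 2 + C (redCoeff W₁.a₄ (m + 3)) * X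
        + C (redCoeff W₁.a₆ (2 * m + 5))) = 2 := by
      rw [hfac₁, distinctRootCount_quadratic₂_rescale D₁.u x2 x2n x4 x6,
        distinctRootCount_quadratic₂_smul hu₁₀ k1 k2 k3 k4 k6 hr₁ hs₁ ht₁]
    by_cases hB : distinctRootCount (C (redCoeff W₁.a₂ 1) * X ^ 2 + C (redCoeff W₁.a₄ (m + 3)) * X
        + C (redCoeff W₁.a₆ (2 * m + 5))) = 2
    · rw [if_pos hB, if_pos (iffB.mpr hB)]
    have hB' := fun h => hB (iffB.mp h)
    rw [if_neg hB, if_neg hB']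
    -- the `x`-translations exist
    have hexB := exists_normalize_istarB k1 k2 k2n k3 k4 k6 hB
    have hexB' := exists_normalize_istarB k1' k2' k2n' k3' k4' k6' hB'
    rw [dif_pos hexB, dif_pos hexB']
    obtain ⟨j1, j2, j2n, j3, j4, j6⟩ := istarB_spec k1 k2 k2n k3 k4 k6 hexB
    obtain ⟨j1', j2', j2n', j3', j4', j6'⟩ := istarB_spec k1' k2' k2n' k3' k4' k6' hexB'
    have hrel₂ : hexB'.choose • W₁' = (hexB'.choose * D₁ * hexB.choose⁻¹) • (hexB.choose • W₁) :=
      smul_eq_conj_smul hrel₁ rfl rfl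
    exact ih (m + 1) hrel₂ j1 j2 j2n j3 j4 j6 j1' j2' j2n' j3' j4' j6'

end Step7

/-! ### Step 7 wrapper and steps 8–9 specialisations -/

section Step789

variable {R : Type*} [CommRing R] [IsDomain R] [IsDiscreteValuationRing R]

/-- **`istarIndex` is well defined**: for two `R`-isomorphic step-6 normalised models whose
cubic has exactly two distinct roots, the initial `x`-translations exist (perfect residue field),
the translated models satisfy `π ∥ a₂` and are `R`-isomorphic, and `istarIndexAux_smul_eq`
applies with the common fuel `ord Δ`. Silverman ATAEC IV.9.4, Step 7. [cite: SilvermanATAEC1994, IV.9.4 Step 7] -/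
theorem istarIndex_smul_eq [PerfectField (ResidueField R)] {W W' : WeierstrassCurve R}
    {D : WeierstrassCurve.VariableChange R} (hrel : W' = D • W)
    (h1 : uniformizer R ∣ W.a₁) (h2 : uniformizer R ∣ W.a₂) (h3 : uniformizer R ^ 2 ∣ W.a₃)
    (h4 : uniformizer R ^ 2 ∣ W.a₄) (h6 : uniformizer R ^ 3 ∣ W.a₆)
    (h1' : uniformizer R ∣ W'.a₁) (h2' : uniformizer R ∣ W'.a₂) (h3' : uniformizer R ^ 2 ∣ W'.a₃)
    (h4' : uniformizer R ^ 2 ∣ W'.a₄) (h6' : uniformizer R ^ 3 ∣ W'.a₆)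
    (h7 : distinctRootCount (cubicStep6 W) = 2) (h7' : distinctRootCount (cubicStep6 W') = 2) :
    istarIndex W' = istarIndex W := by
  classical
  set ϖ := uniformizer R with hϖdef
  have hex := exists_variableChange_step7_of_dvd h1 h2 h3 h4 h6 h7
  have hex' := exists_variableChange_step7_of_dvd h1' h2' h3' h4' h6' h7'
  unfold istarIndex
  rw [dif_pos hex, dif_pos hex']
  simp only []
  have hf : (IsDiscreteValuationRing.addVal R W'.Δ).toNat =
      (IsDiscreteValuationRing.addVal R W.Δ).toNat := by
    rw [hrel]; exact addVal_Δ_smul_toNat D W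
  rw [hf]
  -- specs of the translated models
  obtain ⟨hu, m1, m2, m3, m4, m6⟩ := hex.choose_spec
  have k1 := mem_maximalIdeal_iff_dvd.mp m1
  have k2 := mem_maximalIdeal_iff_dvd.mp m2
  have k3 := mem_maximalIdeal_pow_iff_dvd.mp m3
  have k4 := mem_maximalIdeal_pow_iff_dvd.mp m4
  have k6 := mem_maximalIdeal_pow_iff_dvd.mp m6
  obtain ⟨hu', m1', m2', m3', m4', m6'⟩ := hex'.choose_spec
  have k1' := mem_maximalIdeal_iff_dvd.mp m1'
  have k2' := mem_maximalIdeal_iff_dvd.mp m2'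
  have k3' := mem_maximalIdeal_pow_iff_dvd.mp m3'
  have k4' := mem_maximalIdeal_pow_iff_dvd.mp m4'
  have k6' := mem_maximalIdeal_pow_iff_dvd.mp m6'
  have d23 : ϖ ^ 2 ∣ ϖ ^ 3 := pow_dvd_pow ϖ (by norm_num)
  have d34 : ϖ ^ 3 ∣ ϖ ^ 4 := pow_dvd_pow ϖ (by norm_num)
  -- `π ∥ a₂` on the translated models
  have k2n : ¬ ϖ ^ 2 ∣ (hex.choose • W).a₂ := by
    obtain ⟨hr, hs, ht⟩ := dvd_r_s_t_of_step6 hu h1 h2 h3 h4 h6 k1 k2 k3 (d23.trans k4)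
      (d34.trans k6)
    refine not_sq_dvd_a₂_of_distinctRootCount_eq_two k4 k6 ?_
    rw [distinctRootCount_cubicStep6_smul hu h1 h2 h3 h4 h6 hr hs ht]; exact h7
  have k2n' : ¬ ϖ ^ 2 ∣ (hex'.choose • W').a₂ := by
    obtain ⟨hr, hs, ht⟩ := dvd_r_s_t_of_step6 hu' h1' h2' h3' h4' h6' k1' k2' k3' (d23.trans k4')
      (d34.trans k6')
    refine not_sq_dvd_a₂_of_distinctRootCount_eq_two k4' k6' ?_
    rw [distinctRootCount_cubicStep6_smul hu' h1' h2' h3' h4' h6' hr hs ht]; exact h7'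
  have hrel₇ : hex'.choose • W' = (hex'.choose * D * hex.choose⁻¹) • (hex.choose • W) :=
    smul_eq_conj_smul hrel rfl rfl
  exact istarIndexAux_smul_eq _ 0 hrel₇ k1 k2 k2n k3 k4 k6 k1' k2' k2n' k3' k4' k6'

/-- Step 8 test under a rescaling (specialisation `m = 0` of
`distinctRootCount_quadratic₁_rescale`). [cite: SilvermanATAEC1994, IV.9.4 Step 8] -/
theorem distinctRootCount_quadraticStep8_rescale (u : Rˣ) {W : WeierstrassCurve R}
    (h3 : uniformizer R ^ 2 ∣ W.a₃) (h6 : uniformizer R ^ 4 ∣ W.a₆) :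
    distinctRootCount (quadraticStep8 ((⟨u, 0, 0, 0⟩ : WeierstrassCurve.VariableChange R) • W))
        = 2 ↔ distinctRootCount (quadraticStep8 W) = 2 := by
  have h := distinctRootCount_quadratic₁_rescale u (W := W) (m := 0) (by simpa using h3)
    (by simpa using h6)
  simpa [quadraticStep8] using h

/-- Step 8 test under a `u = 1` change between step-8 normalised models (specialisation `m = 0`
of `distinctRootCount_quadratic₁_smul`). [cite: SilvermanATAEC1994, IV.9.4 Step 8] -/
theorem distinctRootCount_quadraticStep8_smul {W : WeierstrassCurve R}
    {D : WeierstrassCurve.VariableChange R} (hu : D.u = 1) (h1 : uniformizer R ∣ W.a₁)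
    (h2 : uniformizer R ∣ W.a₂) (h3 : uniformizer R ^ 2 ∣ W.a₃) (h4 : uniformizer R ^ 3 ∣ W.a₄)
    (h6 : uniformizer R ^ 4 ∣ W.a₆) (hr : uniformizer R ^ 2 ∣ D.r) (hs : uniformizer R ∣ D.s)
    (ht : uniformizer R ^ 2 ∣ D.t) :
    distinctRootCount (quadraticStep8 (D • W)) = distinctRootCount (quadraticStep8 W) := by
  have h := distinctRootCount_quadratic₁_smul hu (m := 0) h1 h2 (by simpa using h3)
    (by simpa using h4) (by simpa using h6) (by simpa using hr) hs (by simpa using ht)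
  simpa [quadraticStep8] using h

end Step789

end TateAlgorithm

end Literature.NumberTheory.DiophantineGeometry

/-! ### The main theorem -/

namespace WeierstrassCurve

open Literature.NumberTheory.DiophantineGeometry.TateAlgorithm

section DVR

variable {R : Type*} [CommRing R] [IsDomain R] [IsDiscreteValuationRing R]

/-- **Tate's algorithm is well defined** (perfect residue field): the literal implementation
`WeierstrassCurve.kodairaSymbolOfMinimal` of steps 1–10 of Silverman ATAEC IV.9.4 returns the same
Kodaira symbol on `W` and on `D • W` for every change of variables `D` over `R` (i.e. with
`u ∈ Rˣ`), independently of the normalising translations chosen (by `Exists.choose`) along the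
two runs. No minimality or `Δ ≠ 0` hypothesis is needed. Proof: the two runs are coupled step by
step; after each normalisation the two models differ by a change of variables lying in the
subgroup singled out by the rigidity lemmas (`dvd_r_t_of_step2`, `dvd_r_s_t_of_step6`, `…step7`,
`…step7b`, `…step8`, `…step9`), under which every test of the algorithm is invariant.
Tate 1975, §§7–8; Silverman ATAEC IV.9.4 and the remark on `k` perfect (Rem. IV.9.5).
[cite: SilvermanATAEC1994, IV.9.4] [cite: Tate1975, §§7–8] -/
theorem kodairaSymbolOfMinimal_smul [PerfectField (IsLocalRing.ResidueField R)]
    (W : WeierstrassCurve R) (D : VariableChange R) :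
    (D • W).kodairaSymbolOfMinimal = W.kodairaSymbolOfMinimal := by
  classical
  set ϖ := uniformizer R with hϖdef
  unfold kodairaSymbolOfMinimal
  simp only []
  -- Step 1
  have i1 : (D • W).Δ ∉ maximalIdeal R ↔ W.Δ ∉ maximalIdeal R := by
    rw [mem_maximalIdeal_iff_dvd, mem_maximalIdeal_iff_dvd, dvd_Δ_smul_iff]
  by_cases h1 : W.Δ ∉ maximalIdeal R
  · rw [if_pos h1, if_pos (i1.mpr h1)]
  rw [if_neg h1, if_neg (fun h => h1 (i1.mp h))]
  have hΔ : W.Δ ∈ maximalIdeal R := not_not.mp h1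
  have hΔ' : (D • W).Δ ∈ maximalIdeal R := not_not.mp (fun h => h1 (i1.mp h))
  -- Step 2 normalisations
  have hex2 := exists_variableChange_step2_of_perfectField W hΔ
  have hex2' := exists_variableChange_step2_of_perfectField (D • W) hΔ'
  have e2 : normalizeStep2 W = hex2.choose • W := by
    unfold normalizeStep2; rw [dif_pos hex2]
  have e2' : normalizeStep2 (D • W) = hex2'.choose • (D • W) := by
    unfold normalizeStep2; rw [dif_pos hex2']
  rw [e2, e2', addVal_Δ_smul_toNat D W]
  obtain ⟨hu2, p3, p4, p6⟩ := hex2.choose_spec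
  have n3 := mem_maximalIdeal_iff_dvd.mp p3
  have n4 := mem_maximalIdeal_iff_dvd.mp p4
  have n6 := mem_maximalIdeal_iff_dvd.mp p6
  obtain ⟨hu2', p3', p4', p6'⟩ := hex2'.choose_spec
  have n3' := mem_maximalIdeal_iff_dvd.mp p3'
  have n4' := mem_maximalIdeal_iff_dvd.mp p4'
  have n6' := mem_maximalIdeal_iff_dvd.mp p6'
  set W₂ := hex2.choose • W with hW₂
  set W₂' := hex2'.choose • (D • W) with hW₂'
  have hrel₂ : W₂' = (hex2'.choose * D * hex2.choose⁻¹) • W₂ := smul_eq_conj_smul rfl hW₂ hW₂'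
  set D₂ := hex2'.choose * D * hex2.choose⁻¹ with hD₂
  set D₂₀ : VariableChange R := ⟨1, D₂.r, D₂.s, D₂.t⟩ with hD₂₀
  have hu₂₀ : D₂₀.u = 1 := rfl
  have hfac₂ : W₂' = (⟨D₂.u, 0, 0, 0⟩ : VariableChange R) • (D₂₀ • W₂) := by
    rw [hrel₂, smul_eq_rescale_smul]
  clear_value W₂ W₂' D₂ D₂₀
  have v3 : ϖ ∣ (D₂₀ • W₂).a₃ := (dvd_rescale_a₃_iff D₂.u _ _).mp (hfac₂ ▸ n3')
  have v4 : ϖ ∣ (D₂₀ • W₂).a₄ := (dvd_rescale_a₄_iff D₂.u _ _).mp (hfac₂ ▸ n4')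
  have v6 : ϖ ∣ (D₂₀ • W₂).a₆ := (dvd_rescale_a₆_iff D₂.u _ _).mp (hfac₂ ▸ n6')
  obtain ⟨hr₂, ht₂⟩ := dvd_r_t_of_step2 hu₂₀ n3 n4 n6 v3 v4 v6
  -- Step 2 test
  have i2 : W₂'.b₂ ∉ maximalIdeal R ↔ W₂.b₂ ∉ maximalIdeal R := by
    rw [mem_maximalIdeal_iff_dvd, mem_maximalIdeal_iff_dvd, hfac₂, dvd_rescale_b₂_iff,
      dvd_b₂_smul_iff hu₂₀ hr₂]
  by_cases h2 : W₂.b₂ ∉ maximalIdeal R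
  · rw [if_pos h2, if_pos (i2.mpr h2)]
  rw [if_neg h2, if_neg (fun h => h2 (i2.mp h))]
  have hb₂ : ϖ ∣ W₂.b₂ := mem_maximalIdeal_iff_dvd.mp (not_not.mp h2)
  have hb₂' : ϖ ∣ W₂'.b₂ := mem_maximalIdeal_iff_dvd.mp (not_not.mp (fun h => h2 (i2.mp h)))
  -- Step 3 test
  have i3 : W₂'.a₆ ∉ maximalIdeal R ^ 2 ↔ W₂.a₆ ∉ maximalIdeal R ^ 2 := by
    rw [mem_maximalIdeal_pow_iff_dvd, mem_maximalIdeal_pow_iff_dvd, hfac₂, dvd_rescale_a₆_iff,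
      sq_dvd_a₆_smul_iff hu₂₀ n3 n4 hr₂ ht₂]
  by_cases h3 : W₂.a₆ ∉ maximalIdeal R ^ 2
  · rw [if_pos h3, if_pos (i3.mpr h3)]
  rw [if_neg h3, if_neg (fun h => h3 (i3.mp h))]
  have ha₆ : ϖ ^ 2 ∣ W₂.a₆ := mem_maximalIdeal_pow_iff_dvd.mp (not_not.mp h3)
  have ha₆' : ϖ ^ 2 ∣ W₂'.a₆ :=
    mem_maximalIdeal_pow_iff_dvd.mp (not_not.mp (fun h => h3 (i3.mp h)))
  -- Step 4 test
  have i4 : W₂'.b₈ ∉ maximalIdeal R ^ 3 ↔ W₂.b₈ ∉ maximalIdeal R ^ 3 := by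
    rw [mem_maximalIdeal_pow_iff_dvd, mem_maximalIdeal_pow_iff_dvd, hfac₂, dvd_rescale_b₈_iff,
      cube_dvd_b₈_smul_iff hu₂₀ n3 n4 ha₆ hr₂]
  by_cases h4 : W₂.b₈ ∉ maximalIdeal R ^ 3
  · rw [if_pos h4, if_pos (i4.mpr h4)]
  rw [if_neg h4, if_neg (fun h => h4 (i4.mp h))]
  have hb₈ : ϖ ^ 3 ∣ W₂.b₈ := mem_maximalIdeal_pow_iff_dvd.mp (not_not.mp h4)
  have hb₈' : ϖ ^ 3 ∣ W₂'.b₈ :=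
    mem_maximalIdeal_pow_iff_dvd.mp (not_not.mp (fun h => h4 (i4.mp h)))
  -- Step 5 test
  have i5 : W₂'.b₆ ∉ maximalIdeal R ^ 3 ↔ W₂.b₆ ∉ maximalIdeal R ^ 3 := by
    rw [mem_maximalIdeal_pow_iff_dvd, mem_maximalIdeal_pow_iff_dvd, hfac₂, dvd_rescale_b₆_iff,
      cube_dvd_b₆_smul_iff hu₂₀ n3 ha₆ hb₂ hb₈ hr₂]
  by_cases h5 : W₂.b₆ ∉ maximalIdeal R ^ 3
  · rw [if_pos h5, if_pos (i5.mpr h5)]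
  rw [if_neg h5, if_neg (fun h => h5 (i5.mp h))]
  have hb₆ : ϖ ^ 3 ∣ W₂.b₆ := mem_maximalIdeal_pow_iff_dvd.mp (not_not.mp h5)
  have hb₆' : ϖ ^ 3 ∣ W₂'.b₆ :=
    mem_maximalIdeal_pow_iff_dvd.mp (not_not.mp (fun h => h5 (i5.mp h)))
  -- Step 6 normalisations
  have hex6 := exists_variableChange_step6_of_dvd n3 n4 ha₆ hb₂ hb₆ hb₈
  have hex6' := exists_variableChange_step6_of_dvd n3' n4' ha₆' hb₂' hb₆' hb₈'
  have e6 : normalizeStep6 W₂ = hex6.choose • W₂ := by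
    unfold normalizeStep6; rw [dif_pos hex6]
  have e6' : normalizeStep6 W₂' = hex6'.choose • W₂' := by
    unfold normalizeStep6; rw [dif_pos hex6']
  rw [e6, e6']
  obtain ⟨hu6, s1, s2, s3, s4, s6⟩ := hex6.choose_spec
  have q1 := mem_maximalIdeal_iff_dvd.mp s1
  have q2 := mem_maximalIdeal_iff_dvd.mp s2
  have q3 := mem_maximalIdeal_pow_iff_dvd.mp s3
  have q4 := mem_maximalIdeal_pow_iff_dvd.mp s4
  have q6 := mem_maximalIdeal_pow_iff_dvd.mp s6
  obtain ⟨hu6', s1', s2', s3', s4', s6'⟩ := hex6'.choose_spec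
  have q1' := mem_maximalIdeal_iff_dvd.mp s1'
  have q2' := mem_maximalIdeal_iff_dvd.mp s2'
  have q3' := mem_maximalIdeal_pow_iff_dvd.mp s3'
  have q4' := mem_maximalIdeal_pow_iff_dvd.mp s4'
  have q6' := mem_maximalIdeal_pow_iff_dvd.mp s6'
  set W₆ := hex6.choose • W₂ with hW₆
  set W₆' := hex6'.choose • W₂' with hW₆'
  have hrel₆ : W₆' = (hex6'.choose * D₂ * hex6.choose⁻¹) • W₆ := smul_eq_conj_smul hrel₂ hW₆ hW₆'
  set D₆ := hex6'.choose * D₂ * hex6.choose⁻¹ with hD₆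
  set D₆₀ : VariableChange R := ⟨1, D₆.r, D₆.s, D₆.t⟩ with hD₆₀
  have hu₆₀ : D₆₀.u = 1 := rfl
  have hfac₆ : W₆' = (⟨D₆.u, 0, 0, 0⟩ : VariableChange R) • (D₆₀ • W₆) := by
    rw [hrel₆, smul_eq_rescale_smul]
  clear_value W₆ W₆' D₆ D₆₀
  have x1 : ϖ ∣ (D₆₀ • W₆).a₁ := (dvd_rescale_a₁_iff D₆.u _ _).mp (hfac₆ ▸ q1')
  have x2 : ϖ ∣ (D₆₀ • W₆).a₂ := (dvd_rescale_a₂_iff D₆.u _ _).mp (hfac₆ ▸ q2')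
  have x3 : ϖ ^ 2 ∣ (D₆₀ • W₆).a₃ := (dvd_rescale_a₃_iff D₆.u _ _).mp (hfac₆ ▸ q3')
  have x4 : ϖ ^ 2 ∣ (D₆₀ • W₆).a₄ := (dvd_rescale_a₄_iff D₆.u _ _).mp (hfac₆ ▸ q4')
  have x6 : ϖ ^ 3 ∣ (D₆₀ • W₆).a₆ := (dvd_rescale_a₆_iff D₆.u _ _).mp (hfac₆ ▸ q6')
  obtain ⟨hr₆, hs₆, ht₆⟩ := dvd_r_s_t_of_step6 hu₆₀ q1 q2 q3 q4 q6 x1 x2 x3 x4 x6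
  -- Steps 6 and 7 tests
  have i67 := distinctRootCount_cubicStep6_rescale D₆.u x2 x4 x6
  have c6 : distinctRootCount (cubicStep6 (D₆₀ • W₆)) = distinctRootCount (cubicStep6 W₆) :=
    distinctRootCount_cubicStep6_smul hu₆₀ q1 q2 q3 q4 q6 hr₆ hs₆ ht₆
  have i6 : distinctRootCount (cubicStep6 W₆') = 3 ↔ distinctRootCount (cubicStep6 W₆) = 3 := by
    rw [hfac₆, i67.1, c6]
  have i7 : distinctRootCount (cubicStep6 W₆') = 2 ↔ distinctRootCount (cubicStep6 W₆) = 2 := by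
    rw [hfac₆, i67.2, c6]
  by_cases h6 : distinctRootCount (cubicStep6 W₆) = 3
  · rw [if_pos h6, if_pos (i6.mpr h6)]
  rw [if_neg h6, if_neg (fun h => h6 (i6.mp h))]
  by_cases h7 : distinctRootCount (cubicStep6 W₆) = 2
  · rw [if_pos h7, if_pos (i7.mpr h7),
      istarIndex_smul_eq hrel₆ q1 q2 q3 q4 q6 q1' q2' q3' q4' q6' h7 (i7.mpr h7)]
  have h6' := fun h => h6 (i6.mp h)
  have h7' := fun h => h7 (i7.mp h)
  rw [if_neg h7, if_neg h7']
  -- Step 8 normalisations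
  have hex8 := exists_variableChange_step8_of_dvd q1 q2 q3 q4 q6 h6 h7
  have hex8' := exists_variableChange_step8_of_dvd q1' q2' q3' q4' q6' h6' h7'
  have e8 : normalizeStep8 W₆ = hex8.choose • W₆ := by
    unfold normalizeStep8; rw [dif_pos hex8]
  have e8' : normalizeStep8 W₆' = hex8'.choose • W₆' := by
    unfold normalizeStep8; rw [dif_pos hex8']
  rw [e8, e8']
  obtain ⟨hu8, t1, t2, t3, t4, t6⟩ := hex8.choose_spec
  have y1 := mem_maximalIdeal_iff_dvd.mp t1
  have y2 := mem_maximalIdeal_pow_iff_dvd.mp t2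
  have y3 := mem_maximalIdeal_pow_iff_dvd.mp t3
  have y4 := mem_maximalIdeal_pow_iff_dvd.mp t4
  have y6 := mem_maximalIdeal_pow_iff_dvd.mp t6
  obtain ⟨hu8', t1', t2', t3', t4', t6'⟩ := hex8'.choose_spec
  have y1' := mem_maximalIdeal_iff_dvd.mp t1'
  have y2' := mem_maximalIdeal_pow_iff_dvd.mp t2'
  have y3' := mem_maximalIdeal_pow_iff_dvd.mp t3'
  have y4' := mem_maximalIdeal_pow_iff_dvd.mp t4'
  have y6' := mem_maximalIdeal_pow_iff_dvd.mp t6'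
  set W₈ := hex8.choose • W₆ with hW₈
  set W₈' := hex8'.choose • W₆' with hW₈'
  have hrel₈ : W₈' = (hex8'.choose * D₆ * hex8.choose⁻¹) • W₈ := smul_eq_conj_smul hrel₆ hW₈ hW₈'
  set D₈ := hex8'.choose * D₆ * hex8.choose⁻¹ with hD₈
  set D₈₀ : VariableChange R := ⟨1, D₈.r, D₈.s, D₈.t⟩ with hD₈₀
  have hu₈₀ : D₈₀.u = 1 := rfl
  have hfac₈ : W₈' = (⟨D₈.u, 0, 0, 0⟩ : VariableChange R) • (D₈₀ • W₈) := by
    rw [hrel₈, smul_eq_rescale_smul]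
  clear_value W₈ W₈' D₈ D₈₀
  have hd12 : ϖ ∣ ϖ ^ 2 := dvd_pow_self ϖ two_ne_zero
  have z1 : ϖ ∣ (D₈₀ • W₈).a₁ := (dvd_rescale_a₁_iff D₈.u _ _).mp (hfac₈ ▸ y1')
  have z2 : ϖ ^ 2 ∣ (D₈₀ • W₈).a₂ := (dvd_rescale_a₂_iff D₈.u _ _).mp (hfac₈ ▸ y2')
  have z3 : ϖ ^ 2 ∣ (D₈₀ • W₈).a₃ := (dvd_rescale_a₃_iff D₈.u _ _).mp (hfac₈ ▸ y3')
  have z4 : ϖ ^ 3 ∣ (D₈₀ • W₈).a₄ := (dvd_rescale_a₄_iff D₈.u _ _).mp (hfac₈ ▸ y4')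
  have z6 : ϖ ^ 4 ∣ (D₈₀ • W₈).a₆ := (dvd_rescale_a₆_iff D₈.u _ _).mp (hfac₈ ▸ y6')
  obtain ⟨hr₈, hs₈, ht₈⟩ := dvd_r_s_t_of_step8 hu₈₀ y1 y2 y3 y4 y6 z1 z2 z3 z4 z6
  -- Step 8 test
  have i8 : distinctRootCount (quadraticStep8 W₈') = 2 ↔
      distinctRootCount (quadraticStep8 W₈) = 2 := by
    rw [hfac₈, distinctRootCount_quadraticStep8_rescale D₈.u z3 z6,
      distinctRootCount_quadraticStep8_smul hu₈₀ y1 (hd12.trans y2) y3 y4 y6 hr₈ hs₈ ht₈]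
  by_cases h8 : distinctRootCount (quadraticStep8 W₈) = 2
  · rw [if_pos h8, if_pos (i8.mpr h8)]
  have h8' := fun h => h8 (i8.mp h)
  rw [if_neg h8, if_neg h8']
  -- Step 9 normalisations
  have hex9 := exists_variableChange_step9_of_dvd y1 y2 y3 y4 y6 h8
  have hex9' := exists_variableChange_step9_of_dvd y1' y2' y3' y4' y6' h8'
  have e9 : normalizeStep9 W₈ = hex9.choose • W₈ := by
    unfold normalizeStep9; rw [dif_pos hex9]
  have e9' : normalizeStep9 W₈' = hex9'.choose • W₈' := by
    unfold normalizeStep9; rw [dif_pos hex9']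
  rw [e9, e9']
  obtain ⟨hu9, o1, o2, o3, o4, o6⟩ := hex9.choose_spec
  have g1 := mem_maximalIdeal_iff_dvd.mp o1
  have g2 := mem_maximalIdeal_pow_iff_dvd.mp o2
  have g3 := mem_maximalIdeal_pow_iff_dvd.mp o3
  have g4 := mem_maximalIdeal_pow_iff_dvd.mp o4
  have g6 := mem_maximalIdeal_pow_iff_dvd.mp o6
  obtain ⟨hu9', o1', o2', o3', o4', o6'⟩ := hex9'.choose_spec
  have g1' := mem_maximalIdeal_iff_dvd.mp o1'
  have g2' := mem_maximalIdeal_pow_iff_dvd.mp o2'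
  have g3' := mem_maximalIdeal_pow_iff_dvd.mp o3'
  have g4' := mem_maximalIdeal_pow_iff_dvd.mp o4'
  have g6' := mem_maximalIdeal_pow_iff_dvd.mp o6'
  set W₉ := hex9.choose • W₈ with hW₉
  set W₉' := hex9'.choose • W₈' with hW₉'
  have hrel₉ : W₉' = (hex9'.choose * D₈ * hex9.choose⁻¹) • W₉ := smul_eq_conj_smul hrel₈ hW₉ hW₉'
  set D₉ := hex9'.choose * D₈ * hex9.choose⁻¹ with hD₉
  set D₉₀ : VariableChange R := ⟨1, D₉.r, D₉.s, D₉.t⟩ with hD₉₀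
  have hu₉₀ : D₉₀.u = 1 := rfl
  have hfac₉ : W₉' = (⟨D₉.u, 0, 0, 0⟩ : VariableChange R) • (D₉₀ • W₉) := by
    rw [hrel₉, smul_eq_rescale_smul]
  clear_value W₉ W₉' D₉ D₉₀
  have f1 : ϖ ∣ (D₉₀ • W₉).a₁ := (dvd_rescale_a₁_iff D₉.u _ _).mp (hfac₉ ▸ g1')
  have f2 : ϖ ^ 2 ∣ (D₉₀ • W₉).a₂ := (dvd_rescale_a₂_iff D₉.u _ _).mp (hfac₉ ▸ g2')
  have f3 : ϖ ^ 3 ∣ (D₉₀ • W₉).a₃ := (dvd_rescale_a₃_iff D₉.u _ _).mp (hfac₉ ▸ g3')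
  have f4 : ϖ ^ 3 ∣ (D₉₀ • W₉).a₄ := (dvd_rescale_a₄_iff D₉.u _ _).mp (hfac₉ ▸ g4')
  have f6 : ϖ ^ 5 ∣ (D₉₀ • W₉).a₆ := (dvd_rescale_a₆_iff D₉.u _ _).mp (hfac₉ ▸ g6')
  obtain ⟨hr₉, hs₉, ht₉⟩ := dvd_r_s_t_of_step9 hu₉₀ g1 g2 g3 g4 g6 f1 f2 f3 f4 f6
  -- Step 9 test
  have i9 : W₉'.a₄ ∉ maximalIdeal R ^ 4 ↔ W₉.a₄ ∉ maximalIdeal R ^ 4 := by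
    rw [mem_maximalIdeal_pow_iff_dvd, mem_maximalIdeal_pow_iff_dvd, hfac₉, dvd_rescale_a₄_iff,
      pow_four_dvd_a₄_smul_iff hu₉₀ g1 g2 g3 hr₉ hs₉ ht₉]
  by_cases h9 : W₉.a₄ ∉ maximalIdeal R ^ 4
  · rw [if_pos h9, if_pos (i9.mpr h9)]
  rw [if_neg h9, if_neg (fun h => h9 (i9.mp h))]
  have ha₄ : ϖ ^ 4 ∣ W₉.a₄ := mem_maximalIdeal_pow_iff_dvd.mp (not_not.mp h9)
  -- Step 10 test
  have i10 : W₉'.a₆ ∉ maximalIdeal R ^ 6 ↔ W₉.a₆ ∉ maximalIdeal R ^ 6 := by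
    rw [mem_maximalIdeal_pow_iff_dvd, mem_maximalIdeal_pow_iff_dvd, hfac₉, dvd_rescale_a₆_iff,
      pow_six_dvd_a₆_smul_iff hu₉₀ g1 g2 g3 ha₄ hr₉ ht₉]
  by_cases h10 : W₉.a₆ ∉ maximalIdeal R ^ 6
  · rw [if_pos h10, if_pos (i10.mpr h10)]
  rw [if_neg h10, if_neg (fun h => h10 (i10.mp h))]

end DVR

section Holds

variable (R : Type*) [CommRing R] [IsDomain R] [IsDiscreteValuationRing R]
  {K : Type*} [Field K] [Algebra R K] [IsFractionRing R K]

/-- **Discharge of the named fact `WeierstrassCurve.kodairaSymbol_smul`** (Tate's algorithm is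
well defined over a DVR with perfect residue field): for an elliptic `W / K` and `C : VariableChange K`,
`(C • W).kodairaSymbol R = W.kodairaSymbol R`. The chosen minimal models `(C • W).minimal R` and
`W.minimal R` are `K`-isomorphic minimal equations of an elliptic curve, so their integral models
differ by a change of variables over `R` (Silverman AEC VII.1.3(b),
`exists_variableChange_integralModel_eq`), and `kodairaSymbolOfMinimal_smul` applies.
Tate 1975, §§7–8; Silverman ATAEC IV.9.4. [cite: SilvermanATAEC1994, IV.9.4 (PDF pp. 344–346)]
[cite: Tate1975, §§7–8] -/
theorem kodairaSymbol_smul_holds : kodairaSymbol_smul (R := R) (K := K) := by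
  intro _ W _ C
  unfold kodairaSymbol
  have hD : (C • W).minimal R =
      (((C • W).exists_isMinimal R).choose * C * ((W.exists_isMinimal R).choose)⁻¹) •
        W.minimal R := by
    rw [minimal, minimal, mul_smul, mul_smul, inv_smul_smul]
  have hΔ : (W.minimal R).Δ ≠ 0 := by
    rw [minimal, variableChange_Δ]
    exact mul_ne_zero (pow_ne_zero _ (Units.ne_zero _)) W.isUnit_Δ.ne_zero
  obtain ⟨D', -, hD'⟩ := exists_variableChange_integralModel_eq R hD hΔ
  rw [hD']
  exact kodairaSymbolOfMinimal_smul _ _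

end Holds

end WeierstrassCurve
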